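import Mathlib.Topology.MetricSpace.Basic
import HarnessLib

/-!
# Hochman 2025, §4 ("Paths avoiding sparse obstacles"): safe points via envelope hulls — I

This file starts the formalization of the tool of §4 of M. Hochman, *Irreducibility and
periodicity in `ℤ²` symbolic systems* (Discrete Analysis 2025:17), used in §5–§6 to place and to
relocate witnesses: to a multi-scale family of sparse axis-parallel obstacles one associates a set
of *safe points* (Prop. 4.1) which stay away from the (doubled) obstacles, exist on every short
vertical segment, lie on bi-infinite polygonal graphs of small slope made of safe points, and
depend on the family only locally. Hochman obtains them as the complement of the *hull* of the
family of diamonds `◇(2R)` (§4.5), the hull being built in §4.2–4.4 from *jigsaws* (non-negative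
piecewise-linear functions of slope `≤ α` on a bounded interval, Def. 4.2), *double jigsaws*
(Def. 4.4–4.5: the region between `-g₋` and `g₊` over a common *equator*), the operation of
*adjoining a diamond* `G ⋉ D` (Def. 4.6: `g₊ ↦ g₊ ∨ Δ_{q₊,α}`, the tent through the north pole of
`D`, and symmetrically below), and the iterative construction of Def. 4.8 (levels from the top
down; a level-`n` diamond within `hₙ` of an existing piece is adjoined to it, otherwise it starts
a new piece).

## The reformulation used here (and why)

We formalize the same construction in an equivalent but more robust form, the **envelope hull**.
A diamond `D` with centre `c`, half-width `a` and half-height `b` is exactly the region between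
two cones, its *roof* `x ↦ c₂ + b - β|x - c₁|` and its *floor* `x ↦ c₂ - b + β|x - c₁|`
(`β = b/a`; `Diamond.toSet`). For a finite set `S` of diamonds, the *envelope* `env S` is the
region between the lower envelope of the floors and the upper envelope of the roofs
(`SafePoints.env`): the smallest "double jigsaw with globally defined boundary graphs" containing
`⋃ S`. Adjoining a diamond to a piece is then simply adding it to `S` — over the abscissae of `D`
this adds exactly Hochman's tents through the poles of `D` (the boundary of a diamond IS the tent
through its pole), and it fills the vertical gap between `D` and the piece, as `⋉` does. The hull
of Def. 4.8 becomes: every diamond `D` of the family has a *clan* (`SafePoints.clan`), obtained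
from `{D}` by going down the levels below that of `D` and absorbing, at each level, the diamonds of
that level which come within the absorption threshold of the envelope of the clan so far
(`SafePoints.clanStage`, Hochman's step (b)); the hull is the union of the envelopes of all clans
(`SafePoints.hull`), and the safe set is its complement (`SafePoints.safe`). The clan of a diamond
that is itself absorbed into a bigger clan has its envelope inside the bigger envelope, so the
hull is the union over Hochman's "roots" (diamonds added in step (a)); defining it over all
diamonds avoids carrying the root/non-root case distinction through the definitions.

The point of the reformulation is the following property, which §6.3 uses implicitly and which
we could not verify for the hull of Def. 4.8 as printed: **antitonicity** — removing obstacles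
does not destroy safe points (`SafePoints.safe_antitone`). In §6.3, Step A (p. 30: "`w′` is safe
relative to `R_{C_F}`. Thus, by part (1) of Proposition 4.1, it suffices to show that ... if
`S ∈ R_{C∪{F′}}(B′) ∖ R_{C_F}(B′)` then `w′ ∉ 20S`") and likewise Step B (p. 31) pass from safety
with respect to the family `R_{C_F}(B′)` of the ORIGINAL certificate to safety with respect to the
family of the glued certificate, which consists of a SUB-family of `R_{C_F}(B′)` (the frames of
`C_F` kept in Steps A–B; the frames of `C_F` near the gluing boundary are discarded and rebuilt in
Steps C–D) together with new rectangles far from `w′`; this inference needs safety to be antitone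
in the family and local under far additions, not only the sandwich of Prop. 4.1 (1). For the tent
construction of Def. 4.6 the tents hang from the equator of the absorbing piece, so the piece that
a formerly absorbed diamond roots after a removal is not literally contained in the old hull; with
envelopes the roofs and floors are the cones of the member diamonds themselves, membership of
clans is monotone in the family (`SafePoints.clanStage_mono`), and antitonicity is immediate.
The remaining assertions of Prop. 4.1/4.9 (sandwich, vertical segments, safe paths of slope
`≤ h₁/w₁`, locality) are proved for this hull in the sequel files; their proofs follow §4.4.

## Main definitions and statements (this file)

* `SafePoints.Scales` — the scale parameters: half-width `a n`, half-height `b n` of level-`n`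
  diamonds (Hochman: dimensions `wₙ × hₙ`; the absorption threshold `hₙ` is `2 b n`).
* `SafePoints.Diamond`, `Diamond.roof`, `Diamond.floor`, `Diamond.toSet` — level-`n` diamonds as
  double cones (§4.1 "diamond of dimensions `w × h`").
* `SafePoints.env` — the envelope of a finite set of diamonds (replaces double jigsaws, Def. 4.5,
  and adjoining, Def. 4.6); `SafePoints.Near` — "`d(D, G) ≤ hₙ`" of Def. 4.8 (b).
* `SafePoints.clanStage`, `SafePoints.clan`, `SafePoints.hull`, `SafePoints.safe` — Def. 4.8 and
  `safe(R) = ℝ² ∖ ⋃ H` (§4.5), in envelope form.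
* `SafePoints.toSet_subset_hull`, `SafePoints.safe_inter_toSet` — every obstacle lies in the
  hull (Remark 4.7 (1): `G, D ⊆ G ⋉ D`), so safe points avoid all obstacles (the right inclusion
  of Prop. 4.1 (1), for the diamonds).
* `SafePoints.clanStage_mono`, `SafePoints.hull_mono`, `SafePoints.safe_antitone` — clans, hull
  and safe set are monotone/antitone in the family.

## References

* [Hochman2025] M. Hochman, *Irreducibility and periodicity in `ℤ²` symbolic systems*, Discrete
  Analysis 2025:17, §4.1–4.5 (pp. 11–17: Def. 4.2, 4.4–4.6, 4.8, Prop. 4.1, 4.9), §6.3 Steps A–B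
  (pp. 29–32). Read via `lit read arxiv:2401.02273`.
-/

noncomputable section

open Set
open scoped Classical

namespace Literature.Dynamics.SymbolicDynamics

namespace Hochman2025

namespace SafePoints

/-! ### Scales and diamonds -/

/-- The scale parameters of a multi-scale family of diamonds (Prop. 4.9: "all elements of `𝒟ₙ`
having dimensions `wₙ × hₙ`"): level-`n` diamonds have half-width `a n > 0` and half-height
`b n > 0`, hence boundary slope `β n = b n / a n`; the absorption threshold of Def. 4.8 (b)
("`d(D, G) ≤ hₙ`", the full height) is `2 * b n`. [cite: Hochman2025, Def 4.8 and Prop 4.9] -/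
structure Scales where
  /-- half-width of level-`n` diamonds -/
  a : ℕ → ℝ
  /-- half-height of level-`n` diamonds -/
  b : ℕ → ℝ
  a_pos : ∀ n, 0 < a n
  b_pos : ∀ n, 0 < b n

namespace Scales

/-- The boundary slope `βₙ = bₙ / aₙ` of level-`n` diamonds (Prop. 4.9: `αₙ = hₙ / wₙ`).
[cite: Hochman2025, Prop 4.9] -/
def β (σ : Scales) (n : ℕ) : ℝ := σ.b n / σ.a n

/-- Slopes are positive. [folklore] -/
theorem β_pos (σ : Scales) (n : ℕ) : 0 < σ.β n := div_pos (σ.b_pos n) (σ.a_pos n)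

/-- `βₙ aₙ = bₙ`. [folklore] -/
theorem β_mul_a (σ : Scales) (n : ℕ) : σ.β n * σ.a n = σ.b n := by
  unfold β; field_simp [(σ.a_pos n).ne']

end Scales

/-- A level-`n` (rectilinear) diamond, given by its centre; its dimensions are read off the level
(§4.1: "a diamond of dimensions `w × h` is a translate of the closed convex hull of
`(±w/2, 0), (0, ±h/2)`"). [cite: Hochman2025, §4.1] -/
structure Diamond where
  /-- centre (of mass) -/
  c : ℝ × ℝ
  /-- level -/
  n : ℕ

variable {σ : Scales}

namespace Diamond

/-- The *roof* of a diamond: the downward cone `x ↦ c₂ + b - β|x - c₁|` through its north pole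
(this is the tent `Δ_{q₊,α}` of §4.2 translated to the pole, extended to all of `ℝ`).
[cite: Hochman2025, §4.2 (Δ_{p,α}) and Def 4.6] -/
def roof (σ : Scales) (D : Diamond) (x : ℝ) : ℝ := D.c.2 + σ.b D.n - σ.β D.n * |x - D.c.1|

/-- The *floor* of a diamond: the upward cone through its south pole.
[cite: Hochman2025, Def 4.6] -/
def floor (σ : Scales) (D : Diamond) (x : ℝ) : ℝ := D.c.2 - σ.b D.n + σ.β D.n * |x - D.c.1|

/-- The diamond as a plane set: the region between its floor and its roof — exactly the closed
convex hull of its four vertices `c ± (a, 0)`, `c ± (0, b)`. [cite: Hochman2025, §4.1] -/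
def toSet (σ : Scales) (D : Diamond) : Set (ℝ × ℝ) :=
  {q | D.floor σ q.1 ≤ q.2 ∧ q.2 ≤ D.roof σ q.1}

/-- Membership in a diamond: between floor and roof. [folklore] -/
theorem mem_toSet {D : Diamond} {q : ℝ × ℝ} :
    q ∈ D.toSet σ ↔ D.floor σ q.1 ≤ q.2 ∧ q.2 ≤ D.roof σ q.1 := Iff.rfl

/-- Membership in a diamond in the familiar form `|x - c₁|/a + |y - c₂|/b ≤ 1`, cleared of
denominators: `b|x - c₁| + a|y - c₂| ≤ ab`. [cite: Hochman2025, §4.1] -/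
theorem mem_toSet_iff {D : Diamond} {q : ℝ × ℝ} :
    q ∈ D.toSet σ ↔ σ.b D.n * |q.1 - D.c.1| + σ.a D.n * |q.2 - D.c.2| ≤ σ.a D.n * σ.b D.n := by
  have ha := σ.a_pos D.n
  have hβa : σ.β D.n * σ.a D.n = σ.b D.n := σ.β_mul_a D.n
  have hdist : σ.a D.n * (σ.b D.n - σ.β D.n * |q.1 - D.c.1|) =
      σ.a D.n * σ.b D.n - σ.b D.n * |q.1 - D.c.1| := by
    rw [mul_sub, ← hβa]; ring
  rw [mem_toSet, roof, floor]
  constructor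
  · rintro ⟨h1, h2⟩
    have h3 : |q.2 - D.c.2| ≤ σ.b D.n - σ.β D.n * |q.1 - D.c.1| := by
      rw [abs_le]; constructor <;> linarith
    have h4 := mul_le_mul_of_nonneg_left h3 ha.le
    linarith
  · intro h
    have h3 : σ.a D.n * |q.2 - D.c.2| ≤ σ.a D.n * (σ.b D.n - σ.β D.n * |q.1 - D.c.1|) := by
      linarith
    have h4 : |q.2 - D.c.2| ≤ σ.b D.n - σ.β D.n * |q.1 - D.c.1| := le_of_mul_le_mul_left h3 ha
    rw [abs_le] at h4
    constructor <;> linarith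

/-- The centre belongs to the diamond. [folklore] -/
theorem c_mem_toSet (D : Diamond) : D.c ∈ D.toSet σ := by
  rw [mem_toSet_iff]
  simp only [sub_self, abs_zero, mul_zero, add_zero]
  exact (mul_pos (σ.a_pos _) (σ.b_pos _)).le

/-- The north pole `c + (0, b)` belongs to the diamond (it is the apex of the roof). [folklore] -/
theorem north_mem_toSet (D : Diamond) : (D.c.1, D.c.2 + σ.b D.n) ∈ D.toSet σ := by
  simp only [mem_toSet, roof, floor, sub_self, abs_zero, mul_zero, add_zero, sub_zero, le_refl,
    and_true]
  linarith [σ.b_pos D.n]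

/-- The south pole `c - (0, b)` belongs to the diamond. [folklore] -/
theorem south_mem_toSet (D : Diamond) : (D.c.1, D.c.2 - σ.b D.n) ∈ D.toSet σ := by
  simp only [mem_toSet, roof, floor, sub_self, abs_zero, mul_zero, add_zero, sub_zero, le_refl,
    true_and]
  linarith [σ.b_pos D.n]

/-- Points of a diamond lie within `a` of the centre horizontally. [folklore] -/
theorem abs_sub_le_a {D : Diamond} {q : ℝ × ℝ} (hq : q ∈ D.toSet σ) :
    |q.1 - D.c.1| ≤ σ.a D.n := by
  rw [mem_toSet_iff] at hq
  have ha := σ.a_pos D.n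
  have hb := σ.b_pos D.n
  have h1 : σ.b D.n * |q.1 - D.c.1| ≤ σ.b D.n * σ.a D.n := by
    nlinarith [abs_nonneg (q.2 - D.c.2)]
  exact le_of_mul_le_mul_left h1 hb

/-- Points of a diamond lie within `b` of the centre vertically. [folklore] -/
theorem abs_sub_le_b {D : Diamond} {q : ℝ × ℝ} (hq : q ∈ D.toSet σ) :
    |q.2 - D.c.2| ≤ σ.b D.n := by
  rw [mem_toSet_iff] at hq
  have ha := σ.a_pos D.n
  have hb := σ.b_pos D.n
  have h1 : σ.a D.n * |q.2 - D.c.2| ≤ σ.a D.n * σ.b D.n := by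
    nlinarith [abs_nonneg (q.1 - D.c.1)]
  exact le_of_mul_le_mul_left h1 ha

end Diamond

/-! ### Envelopes (double jigsaws) -/

/-- The **envelope** of a finite set `S` of diamonds: the points lying on or below the roof of
some member and on or above the floor of some member — the region between the lower envelope of
the floors and the upper envelope of the roofs. This is the envelope form of a double jigsaw
(Def. 4.5) all of whose tents are the cones of member diamonds; adjoining a diamond (Def. 4.6) is
inserting it into `S`. [cite: Hochman2025, Def 4.5–4.6] -/
def env (σ : Scales) (S : Finset Diamond) : Set (ℝ × ℝ) :=
  {q | (∃ D ∈ S, D.floor σ q.1 ≤ q.2) ∧ ∃ D ∈ S, q.2 ≤ D.roof σ q.1}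

/-- Membership in an envelope. [folklore] -/
theorem mem_env {S : Finset Diamond} {q : ℝ × ℝ} :
    q ∈ env σ S ↔ (∃ D ∈ S, D.floor σ q.1 ≤ q.2) ∧ ∃ D ∈ S, q.2 ≤ D.roof σ q.1 := Iff.rfl

/-- Each member diamond lies in the envelope (Remark 4.7 (1): `G, D ⊆ G ⋉ D`).
[cite: Hochman2025, Remark 4.7] -/
theorem toSet_subset_env {S : Finset Diamond} {D : Diamond} (hD : D ∈ S) :
    D.toSet σ ⊆ env σ S :=
  fun _ hq => ⟨⟨D, hD, hq.1⟩, ⟨D, hD, hq.2⟩⟩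

/-- Envelopes are monotone (Remark 4.7 (1)–(2)). [cite: Hochman2025, Remark 4.7] -/
theorem env_mono {S T : Finset Diamond} (h : S ⊆ T) : env σ S ⊆ env σ T := by
  rintro q ⟨⟨D, hD, hDq⟩, ⟨D', hD', hD'q⟩⟩
  exact ⟨⟨D, h hD, hDq⟩, ⟨D', h hD', hD'q⟩⟩

/-- The envelope of one diamond is the diamond. [folklore] -/
@[simp] theorem env_singleton (D : Diamond) : env σ {D} = D.toSet σ := by
  ext q
  simp [mem_env, Diamond.mem_toSet]

/-- "`d(D, G) ≤ r`" of Def. 4.8 (b): some point of the diamond `D` is within `r` (sup-metric of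
`ℝ × ℝ`) of some point of the envelope of `S`. [cite: Hochman2025, Def 4.8] -/
def Near (σ : Scales) (D : Diamond) (S : Finset Diamond) (r : ℝ) : Prop :=
  ∃ q ∈ D.toSet σ, ∃ q' ∈ env σ S, dist q q' ≤ r

/-- Nearness is monotone in the set. [folklore] -/
theorem Near.mono {D : Diamond} {S T : Finset Diamond} {r : ℝ} (h : Near σ D S r) (hST : S ⊆ T) :
    Near σ D T r := by
  obtain ⟨q, hq, q', hq', hd⟩ := h
  exact ⟨q, hq, q', env_mono hST hq', hd⟩

/-! ### Clans, the hull, and safe points (Def. 4.8, §4.5) -/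

/-- **The clan of a diamond, by stages** (Def. 4.8 in envelope form). Stage `0` is `{D}`; stage
`m + 1` adds the diamonds of the family `F` of level `D.n - (m+1)` (the next level down) that come
within their absorption threshold of the envelope of stage `m` (step (b) of Def. 4.8: "choose
`G ∈ H` with `d(D, G) ≤ hₙ` ... replace it with `G ⋉ D`"). Levels are processed from the top
down, as in Def. 4.8, and only strictly lower levels are absorbed (two diamonds of the same level
are never within threshold of each other under the sparsity hypotheses of Prop. 4.9).
[cite: Hochman2025, Def 4.8] -/
def clanStage (σ : Scales) (F : Finset Diamond) (D : Diamond) : ℕ → Finset Diamond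
  | 0 => {D}
  | m + 1 =>
    clanStage σ F D m ∪
      F.filter fun E => E.n + (m + 1) = D.n ∧ Near σ E (clanStage σ F D m) (2 * σ.b E.n)

/-- The clan of `D` in the family `F`: all stages, down to level `0`. [cite: Hochman2025, Def 4.8] -/
def clan (σ : Scales) (F : Finset Diamond) (D : Diamond) : Finset Diamond := clanStage σ F D D.n

/-- **The hull** of a finite family of diamonds (Def. 4.8): the union of the envelopes of the
clans of its members. (The envelope of the clan of an absorbed diamond lies inside the envelope of
the absorbing clan, so this is the union over Hochman's roots.) [cite: Hochman2025, Def 4.8] -/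
def hull (σ : Scales) (F : Finset Diamond) : Set (ℝ × ℝ) := ⋃ D ∈ F, env σ (clan σ F D)

/-- **Safe points** relative to a family of diamonds: the complement of its hull (§4.5:
"`safe(R₁, …, R_N) = ℝ² ∖ H(𝒟₁, …, 𝒟_N)`"; the passage from rectangles `R` to the diamonds
`◇(2R)` is made when Prop. 4.1 is assembled). [cite: Hochman2025, §4.5] -/
def safe (σ : Scales) (F : Finset Diamond) : Set (ℝ × ℝ) := (hull σ F)ᶜ

/-- `D` is the stage-`0` clan. [folklore] -/
theorem mem_clanStage_zero (F : Finset Diamond) (D : Diamond) : D ∈ clanStage σ F D 0 :=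
  Finset.mem_singleton_self D

/-- Stage `0`, unfolded. [folklore] -/
theorem clanStage_zero (F : Finset Diamond) (D : Diamond) : clanStage σ F D 0 = {D} := rfl

/-- Stage `m + 1`, unfolded. [cite: Hochman2025, Def 4.8] -/
theorem clanStage_succ (F : Finset Diamond) (D : Diamond) (m : ℕ) :
    clanStage σ F D (m + 1) = clanStage σ F D m ∪
      F.filter fun E => E.n + (m + 1) = D.n ∧ Near σ E (clanStage σ F D m) (2 * σ.b E.n) := rfl

/-- Stages increase. [folklore] -/
theorem clanStage_subset_succ (F : Finset Diamond) (D : Diamond) (m : ℕ) :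
    clanStage σ F D m ⊆ clanStage σ F D (m + 1) := by
  rw [clanStage_succ]; exact Finset.subset_union_left

/-- Stages increase (general form). [folklore] -/
theorem clanStage_subset_of_le (F : Finset Diamond) (D : Diamond) {m m' : ℕ} (h : m ≤ m') :
    clanStage σ F D m ⊆ clanStage σ F D m' := by
  induction h with
  | refl => exact Finset.Subset.refl _
  | step _ ih => exact fun E hE => clanStage_subset_succ F D _ (ih hE)

/-- `D` belongs to every stage of its clan. [folklore] -/
theorem self_mem_clanStage (F : Finset Diamond) (D : Diamond) (m : ℕ) : D ∈ clanStage σ F D m :=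
  clanStage_subset_of_le F D (Nat.zero_le m) (mem_clanStage_zero F D)

/-- `D` belongs to its clan. [folklore] -/
theorem self_mem_clan (F : Finset Diamond) (D : Diamond) : D ∈ clan σ F D :=
  self_mem_clanStage F D _

/-- Stage `m` consists of `D` and members of `F` of level `≥ D.n - m`, more precisely of level
`D.n - j` for some `1 ≤ j ≤ m` (with `j ≤ D.n`). [folklore] -/
theorem mem_clanStage_iff_level {F : Finset Diamond} {D E : Diamond} {m : ℕ}
    (hE : E ∈ clanStage σ F D m) : E = D ∨ (E ∈ F ∧ E.n < D.n ∧ D.n ≤ E.n + m) := by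
  induction m with
  | zero => exact Or.inl (Finset.mem_singleton.mp hE)
  | succ m ih =>
    rw [clanStage_succ, Finset.mem_union, Finset.mem_filter] at hE
    rcases hE with h | ⟨hF, hlev, -⟩
    · rcases ih h with rfl | ⟨hF, h1, h2⟩
      · exact Or.inl rfl
      · exact Or.inr ⟨hF, h1, by omega⟩
    · exact Or.inr ⟨hF, by omega, by omega⟩

/-- Clans live inside `insert D F`. [folklore] -/
theorem clanStage_subset_insert (F : Finset Diamond) (D : Diamond) (m : ℕ) :
    clanStage σ F D m ⊆ insert D F := by
  intro E hE
  rcases mem_clanStage_iff_level hE with rfl | ⟨hF, -, -⟩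
  · exact Finset.mem_insert_self _ _
  · exact Finset.mem_insert_of_mem hF

/-- The clan of a member of `F` lies in `F`. [folklore] -/
theorem clan_subset (F : Finset Diamond) {D : Diamond} (hD : D ∈ F) : clan σ F D ⊆ F := by
  intro E hE
  have := clanStage_subset_insert F D _ hE
  rwa [Finset.insert_eq_of_mem hD] at this

/-- Absorbed members have strictly smaller level. [cite: Hochman2025, Def 4.8] -/
theorem level_lt_of_mem_clan {F : Finset Diamond} {D E : Diamond} (hE : E ∈ clan σ F D)
    (hne : E ≠ D) : E.n < D.n := by
  rcases mem_clanStage_iff_level hE with h | ⟨-, h, -⟩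
  · exact absurd h hne
  · exact h

/-- **Every obstacle lies in the hull** (through its own clan), so safe points avoid every
diamond of the family: the right-hand inclusion of Prop. 4.1 (1) / Prop. 4.9, for diamonds.
[cite: Hochman2025, Prop 4.1 (1)] -/
theorem toSet_subset_hull {F : Finset Diamond} {D : Diamond} (hD : D ∈ F) :
    D.toSet σ ⊆ hull σ F := by
  intro q hq
  simp only [hull, mem_iUnion]
  exact ⟨D, hD, toSet_subset_env (self_mem_clan F D) hq⟩

/-- The envelope of every clan lies in the hull. [folklore] -/
theorem env_clan_subset_hull {F : Finset Diamond} {D : Diamond} (hD : D ∈ F) :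
    env σ (clan σ F D) ⊆ hull σ F := by
  intro q hq
  simp only [hull, mem_iUnion]
  exact ⟨D, hD, hq⟩

/-- Membership in the hull. [folklore] -/
theorem mem_hull_iff {F : Finset Diamond} {q : ℝ × ℝ} :
    q ∈ hull σ F ↔ ∃ D ∈ F, q ∈ env σ (clan σ F D) := by
  simp only [hull, mem_iUnion, exists_prop]

/-- Membership in the safe set. [folklore] -/
theorem mem_safe_iff {F : Finset Diamond} {q : ℝ × ℝ} :
    q ∈ safe σ F ↔ ∀ D ∈ F, q ∉ env σ (clan σ F D) := by
  simp only [safe, mem_compl_iff, mem_hull_iff, not_exists, not_and]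

/-- Safe points lie outside every diamond of the family. [cite: Hochman2025, Prop 4.1 (1)] -/
theorem safe_inter_toSet {F : Finset Diamond} {D : Diamond} (hD : D ∈ F) :
    safe σ F ∩ D.toSet σ = ∅ := by
  ext q
  simp only [mem_inter_iff, mem_empty_iff_false, iff_false, not_and]
  exact fun hs hq => hs (toSet_subset_hull hD hq)

/-! ### Monotonicity in the family: antitonicity of the safe set -/

/-- **Clans are monotone in the family**: enlarging the family can only enlarge every stage of
every clan (a bigger envelope is closer to everything, so it absorbs at least the same diamonds).
[cite: Hochman2025, Def 4.8 (envelope form)] -/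
theorem clanStage_mono {F F' : Finset Diamond} (h : F' ⊆ F) (D : Diamond) (m : ℕ) :
    clanStage σ F' D m ⊆ clanStage σ F D m := by
  induction m with
  | zero => exact Finset.Subset.refl _
  | succ m ih =>
    rw [clanStage_succ, clanStage_succ]
    refine Finset.union_subset_union ih fun E hE => ?_
    rw [Finset.mem_filter] at hE ⊢
    exact ⟨h hE.1, hE.2.1, hE.2.2.mono ih⟩

/-- Clans are monotone in the family. [folklore] -/
theorem clan_mono {F F' : Finset Diamond} (h : F' ⊆ F) (D : Diamond) :
    clan σ F' D ⊆ clan σ F D :=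
  clanStage_mono h D _

/-- **The hull is monotone in the family.** [cite: Hochman2025, Def 4.8 (envelope form)] -/
theorem hull_mono {F F' : Finset Diamond} (h : F' ⊆ F) : hull σ F' ⊆ hull σ F := by
  intro q hq
  rw [mem_hull_iff] at hq ⊢
  obtain ⟨D, hD, hq⟩ := hq
  exact ⟨D, h hD, env_mono (clan_mono h D) hq⟩

/-- **Antitonicity of safety**: a point that is safe relative to a family of obstacles is safe
relative to every sub-family. This is the property used implicitly in §6.3 Steps A–B, where a
witness known to be safe for the family `R_{C_F}(B′)` of the original certificate is declared safe
for the family of the glued certificate, a sub-family of it enlarged by far-away rectangles.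
[cite: Hochman2025, §6.3 Step A (p. 30) and Step B (p. 31)] -/
theorem safe_antitone {F F' : Finset Diamond} (h : F' ⊆ F) : safe σ F ⊆ safe σ F' :=
  compl_subset_compl.mpr (hull_mono h)

/-! ### The clan of an absorbed diamond adds nothing to the hull -/

/-- If `E` belongs to stage `m` of the clan of `D`, then every stage of the clan of `E` is
contained in the corresponding later stage of the clan of `D`: whatever comes close to the
envelope of `E`'s clan comes close to the bigger envelope of `D`'s clan. Hence the hull is the
union of the envelopes of the clans of the non-absorbed diamonds only (Hochman's pieces).
[cite: Hochman2025, Def 4.8] -/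
theorem clanStage_subset_of_mem {F : Finset Diamond} {D E : Diamond} {m : ℕ}
    (hE : E ∈ clanStage σ F D m) (hlev : E.n + m = D.n) (j : ℕ) :
    clanStage σ F E j ⊆ clanStage σ F D (m + j) := by
  induction j with
  | zero =>
    intro E' hE'
    rw [clanStage_zero, Finset.mem_singleton] at hE'
    subst hE'
    simpa using hE
  | succ j ih =>
    rw [clanStage_succ, ← add_assoc, clanStage_succ]
    refine Finset.union_subset_union ih fun E' hE' => ?_
    rw [Finset.mem_filter] at hE' ⊢
    exact ⟨hE'.1, by omega, hE'.2.2.mono ih⟩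

/-- The envelope of the clan of an absorbed diamond lies inside the envelope of the absorbing
clan. [cite: Hochman2025, Def 4.8] -/
theorem env_clan_subset_of_mem_clan {F : Finset Diamond} {D E : Diamond}
    (hE : E ∈ clan σ F D) : env σ (clan σ F E) ⊆ env σ (clan σ F D) := by
  refine env_mono ?_
  rcases mem_clanStage_iff_level hE with rfl | ⟨-, hlt, -⟩
  · exact Finset.Subset.refl _
  · -- `E` enters at the stage `m = D.n - E.n`, and stays
    have key : E ∈ clanStage σ F D (D.n - E.n) := by
      -- membership in the final stage with the level constraint forces membership at stage
      -- `D.n - E.n`: prove the general statement by induction on the stage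
      suffices h : ∀ m, E ∈ clanStage σ F D m → E.n < D.n → E ∈ clanStage σ F D (D.n - E.n) from
        h _ hE hlt
      intro m
      induction m with
      | zero =>
        intro h0 hlt'
        rw [clanStage_zero, Finset.mem_singleton] at h0
        subst h0
        exact absurd hlt' (lt_irrefl _)
      | succ m ih =>
        intro hm hlt'
        rw [clanStage_succ, Finset.mem_union] at hm
        rcases hm with hm | hm
        · exact ih hm hlt'
        · have hlev : E.n + (m + 1) = D.n := (Finset.mem_filter.mp hm).2.1
          have : D.n - E.n = m + 1 := by omega
          rw [this, clanStage_succ, Finset.mem_union]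
          exact Or.inr hm
    have hsub := clanStage_subset_of_mem key (by omega) E.n
    exact fun E' hE' => clanStage_subset_of_le F D (by omega) (hsub hE')


/-! ### Quantitative hypotheses on the scales (Prop. 4.9 (b)–(c), Prop. 4.1) -/

namespace Scales

/-- **The standing inequalities between the scales**, with one ratio `Λ ≥ 10` (Prop. 4.1:
"`hₙ ≫ wₙ₋₁, hₙ₋₁`, `wₙ ≫ hₙ, wₙ₋₁`"; Prop. 4.9 (b) "`hₙ > 10 h_{≤n-1}`, `wₙ > 10 w_{≤n-1}`",
(c) "`αₙ < α_{n-1}/10`"): diamonds are flat (`Λ bₙ ≤ aₙ`), consecutive levels are separated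
(`Λ aₙ ≤ bₙ₊₁`), and slopes decrease (`Λ βₙ₊₁ ≤ βₙ`). [cite: Hochman2025, Prop 4.1 and Prop 4.9] -/
structure Good (σ : Scales) (Λ : ℝ) : Prop where
  ten_le : 10 ≤ Λ
  flat : ∀ n, Λ * σ.b n ≤ σ.a n
  sep : ∀ n, Λ * σ.a n ≤ σ.b (n + 1)
  slope : ∀ n, Λ * σ.β (n + 1) ≤ σ.β n

namespace Good

variable {Λ : ℝ} (h : σ.Good Λ)
include h

/-- `Λ > 0`. [folklore] -/
theorem pos : 0 < Λ := lt_of_lt_of_le (by norm_num) h.ten_le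

/-- `Λ ≥ 1`. [folklore] -/
theorem one_le : 1 ≤ Λ := le_trans (by norm_num) h.ten_le

/-- `βₙ ≤ 1/10` (flat diamonds). [folklore] -/
theorem β_le (n : ℕ) : σ.β n ≤ 1 / 10 := by
  have hb := h.flat n
  have ha := σ.a_pos n
  unfold Scales.β
  rw [div_le_div_iff₀ ha (by norm_num : (0:ℝ) < 10)]
  nlinarith [h.ten_le, σ.b_pos n]

/-- `βₙ bₙ ≤ bₙ / 10`. [folklore] -/
theorem β_mul_b_le (n : ℕ) : σ.β n * σ.b n ≤ σ.b n / 10 := by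
  have := h.β_le n
  have hb := σ.b_pos n
  nlinarith

/-- `bₙ ≤ aₙ / 10`. [folklore] -/
theorem b_le (n : ℕ) : σ.b n ≤ σ.a n / 10 := by
  have := h.flat n
  nlinarith [h.ten_le, σ.b_pos n]

/-- Slopes decrease along the levels: `β m ≤ β n / 10` for `n < m` (Prop. 4.9 (c)).
[cite: Hochman2025, Prop 4.9 (c)] -/
theorem β_lt_le {n m : ℕ} (hnm : n < m) : σ.β m ≤ σ.β n / 10 := by
  have hΛ := h.pos
  have key : ∀ k, σ.β (n + 1 + k) ≤ σ.β n / 10 := by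
    intro k
    induction k with
    | zero =>
      have := h.slope n
      rw [le_div_iff₀ (by norm_num : (0:ℝ) < 10)]
      nlinarith [h.ten_le, σ.β_pos (n + 1)]
    | succ k ih =>
      have hs := h.slope (n + 1 + k)
      have : σ.β (n + 1 + (k + 1)) ≤ σ.β (n + 1 + k) := by
        rw [show n + 1 + (k + 1) = n + 1 + k + 1 by ring]
        nlinarith [h.one_le, σ.β_pos (n + 1 + k + 1)]
      exact this.trans ih
  obtain ⟨k, rfl⟩ := Nat.exists_eq_add_of_lt hnm
  have := key k
  rwa [show n + 1 + k = n + k + 1 by ring] at this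

/-- Heights grow at least hundredfold per level: `100 bₙ ≤ bₘ` for `n < m` (Prop. 4.9 (b)).
[cite: Hochman2025, Prop 4.9 (b)] -/
theorem b_lt_le {n m : ℕ} (hnm : n < m) : 100 * σ.b n ≤ σ.b m := by
  have step : ∀ k, 100 * σ.b k ≤ σ.b (k + 1) := by
    intro k
    have h1 := h.flat k
    have h2 := h.sep k
    have hΛ := h.ten_le
    have hb := σ.b_pos k
    have ha := σ.a_pos k
    have hΛ2 : (100 : ℝ) ≤ Λ * Λ := by nlinarith
    calc 100 * σ.b k ≤ Λ * (Λ * σ.b k) := by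
          nlinarith [mul_nonneg (sub_nonneg.mpr hΛ2) hb.le]
      _ ≤ Λ * σ.a k := by nlinarith [h.pos]
      _ ≤ σ.b (k + 1) := h2
  have key : ∀ k, 100 * σ.b n ≤ σ.b (n + 1 + k) := by
    intro k
    induction k with
    | zero => exact step n
    | succ k ih =>
      have := step (n + 1 + k)
      rw [show n + 1 + (k + 1) = n + 1 + k + 1 by ring]
      nlinarith [σ.b_pos (n + 1 + k)]
  obtain ⟨k, rfl⟩ := Nat.exists_eq_add_of_lt hnm
  have := key k
  rwa [show n + 1 + k = n + k + 1 by ring] at this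

/-- Heights are monotone in the level. [folklore] -/
theorem b_mono {n m : ℕ} (hnm : n ≤ m) : σ.b n ≤ σ.b m := by
  rcases hnm.lt_or_eq with hlt | rfl
  · have := h.b_lt_le hlt
    nlinarith [σ.b_pos n]
  · exact le_rfl

/-- Widths of lower levels are small against heights of higher levels: `10 aₙ ≤ bₘ` for `n < m`
(Prop. 4.1: `hₙ ≫ wₙ₋₁`). [cite: Hochman2025, Prop 4.1] -/
theorem a_lt_le {n m : ℕ} (hnm : n < m) : 10 * σ.a n ≤ σ.b m := by
  have h2 := h.sep n
  have : 10 * σ.a n ≤ σ.b (n + 1) := by nlinarith [h.ten_le, σ.a_pos n]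
  exact this.trans (h.b_mono hnm)

end Good

end Scales

/-! ### Gauge and sparsity (§4.1 "`c`-sparse") -/

/-- The gauge of level `n`: `ν_n(v) = |v₁|/aₙ + |v₂|/bₙ`, the norm whose unit ball is a level-`n`
diamond centred at the origin; `K ⬨ D = {q | ν_n(q - c) ≤ K}` is the scaled diamond `K·D` of §4.1
("`cE` ... a translate of `{cx | x ∈ E}` with the same center of mass"). [cite: Hochman2025, §4.1] -/
def gauge (σ : Scales) (n : ℕ) (v : ℝ × ℝ) : ℝ := |v.1| / σ.a n + |v.2| / σ.b n

/-- The scaled diamond `K·D` (same centre, dimensions multiplied by `K`). [cite: Hochman2025, §4.1] -/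
def Diamond.scaled (σ : Scales) (D : Diamond) (K : ℝ) : Set (ℝ × ℝ) :=
  {q | gauge σ D.n (q - D.c) ≤ K}

/-- The gauge is non-negative. [folklore] -/
theorem gauge_nonneg (n : ℕ) (v : ℝ × ℝ) : 0 ≤ gauge σ n v :=
  add_nonneg (div_nonneg (abs_nonneg _) (σ.a_pos n).le) (div_nonneg (abs_nonneg _) (σ.b_pos n).le)

/-- `ν ≤ K` cleared of denominators. [folklore] -/
theorem gauge_le_iff {n : ℕ} {v : ℝ × ℝ} {K : ℝ} :
    gauge σ n v ≤ K ↔ σ.b n * |v.1| + σ.a n * |v.2| ≤ K * (σ.a n * σ.b n) := by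
  have ha := σ.a_pos n
  have hb := σ.b_pos n
  unfold gauge
  rw [div_add_div _ _ ha.ne' hb.ne', div_le_iff₀ (mul_pos ha hb)]
  constructor <;> intro h' <;> nlinarith

/-- `K ≤ ν` cleared of denominators. [folklore] -/
theorem le_gauge_iff {n : ℕ} {v : ℝ × ℝ} {K : ℝ} :
    K ≤ gauge σ n v ↔ K * (σ.a n * σ.b n) ≤ σ.b n * |v.1| + σ.a n * |v.2| := by
  have ha := σ.a_pos n
  have hb := σ.b_pos n
  unfold gauge
  rw [div_add_div _ _ ha.ne' hb.ne', le_div_iff₀ (mul_pos ha hb)]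
  constructor <;> intro h' <;> nlinarith

/-- A diamond is its own unit gauge ball. [cite: Hochman2025, §4.1] -/
theorem Diamond.toSet_eq_scaled_one (D : Diamond) : D.toSet σ = D.scaled σ 1 := by
  ext q
  rw [Diamond.mem_toSet_iff, Diamond.scaled, mem_setOf_eq, gauge_le_iff]
  simp [Prod.fst_sub, Prod.snd_sub]

/-- Scaled diamonds increase with the factor. [folklore] -/
theorem Diamond.scaled_mono (D : Diamond) {K K' : ℝ} (hK : K ≤ K') :
    D.scaled σ K ⊆ D.scaled σ K' :=
  fun _ hq => le_trans hq hK

/-- **Sparsity** (§4.1: "`ℰ` is `c`-sparse if `E ∩ cE′ = cE ∩ E′ = ∅` for distinct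
`E, E′ ∈ ℰ`"), for diamonds in gauge form: distinct diamonds of the same level have centres at
gauge distance `≥ Λₛ` (for gauge balls, `D ∩ cD′ = ∅` iff `ν(c - c′) > 1 + c`).
[cite: Hochman2025, §4.1] -/
def IsSparse (σ : Scales) (F : Finset Diamond) (Λs : ℝ) : Prop :=
  ∀ D ∈ F, ∀ D' ∈ F, D ≠ D' → D.n = D'.n → Λs ≤ gauge σ D.n (D.c - D'.c)

/-- Sub-families of sparse families are sparse. [folklore] -/
theorem IsSparse.mono {F F' : Finset Diamond} {Λs : ℝ} (hF : IsSparse σ F Λs) (h : F' ⊆ F) :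
    IsSparse σ F' Λs :=
  fun D hD D' hD' hne hn => hF D (h hD) D' (h hD') hne hn

/-- Sparsity with a larger constant implies it with a smaller one. [folklore] -/
theorem IsSparse.of_le {F : Finset Diamond} {Λs Λs' : ℝ} (hF : IsSparse σ F Λs) (h : Λs' ≤ Λs) :
    IsSparse σ F Λs' :=
  fun D hD D' hD' hne hn => h.trans (hF D hD D' hD' hne hn)

/-! ### The bump of an absorbed diamond (Lemma 4.3, Prop. 4.9 (1)) -/

/-- Distances in `ℝ × ℝ` (sup-metric), coordinatewise. [folklore] -/
theorem abs_sub_le_of_dist_le {q q' : ℝ × ℝ} {r : ℝ} (h : dist q q' ≤ r) :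
    |q.1 - q'.1| ≤ r ∧ |q.2 - q'.2| ≤ r := by
  rw [Prod.dist_eq, max_le_iff, Real.dist_eq, Real.dist_eq] at h
  exact h

/-- **The roof bump of an absorbed diamond** (envelope form of Lemma 4.3 / first part of the
proof of Prop. 4.9 (1)): if the diamond `E` comes within its height `2b` of the envelope of a set
`S` of diamonds of higher levels (flatter slopes), then its roof is dominated by the roof of a
member `E₀` of `S` up to `5b` everywhere, and outright at horizontal distance `≥ 6a` from the
centre of `E` — the roof of `E` changes the envelope only inside a box of dimensions
`12a × 5b` around `E` (Hochman: `5wₙ × 5hₙ`). [cite: Hochman2025, Lemma 4.3 and Prop 4.9 (1)] -/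
theorem exists_roof_dom {Λ : ℝ} (hσ : σ.Good Λ) {S : Finset Diamond} {E : Diamond}
    (hS : ∀ E' ∈ S, E.n < E'.n) (hnear : Near σ E S (2 * σ.b E.n)) :
    ∃ E₀ ∈ S, ∀ x, E.roof σ x ≤ E₀.roof σ x + 5 * σ.b E.n ∧
      (6 * σ.a E.n ≤ |x - E.c.1| → E.roof σ x ≤ E₀.roof σ x) := by
  obtain ⟨q, hq, q', hq', hd⟩ := hnear
  obtain ⟨hd1, hd2⟩ := abs_sub_le_of_dist_le hd
  obtain ⟨-, E₀, hE₀, hq'roof⟩ := hq'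
  refine ⟨E₀, hE₀, fun x => ?_⟩
  -- notation
  have hb := σ.b_pos E.n
  have ha := σ.a_pos E.n
  have hβ := σ.β_pos E.n
  have hβ₀ := σ.β_pos E₀.n
  have hβa : σ.β E.n * σ.a E.n = σ.b E.n := σ.β_mul_a E.n
  have hβle : σ.β E₀.n ≤ σ.β E.n / 10 := hσ.β_lt_le (hS E₀ hE₀)
  have hβb : σ.β E.n * σ.b E.n ≤ σ.b E.n / 10 := hσ.β_mul_b_le E.n
  -- `E.c.2 ≤ q.2 + b`, `q.2 ≤ q'.2 + 2b`
  have h1 : E.c.2 ≤ q.2 + σ.b E.n := by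
    have := Diamond.abs_sub_le_b hq
    rw [abs_le] at this; linarith
  have h2 : q.2 ≤ q'.2 + 2 * σ.b E.n := by rw [abs_le] at hd2; linarith
  -- horizontal bookkeeping
  have hqx : |q.1 - E.c.1| ≤ σ.a E.n := Diamond.abs_sub_le_a hq
  have hx' : |x - q'.1| ≤ |x - E.c.1| + σ.a E.n + 2 * σ.b E.n := by
    have t1 : |x - q'.1| ≤ |x - E.c.1| + |E.c.1 - q'.1| := abs_sub_le _ _ _
    have t2 : |E.c.1 - q'.1| ≤ |E.c.1 - q.1| + |q.1 - q'.1| := abs_sub_le _ _ _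
    rw [abs_sub_comm E.c.1 q.1] at t2
    linarith
  -- the roof of `E₀` at `x` versus at `q'.1`
  have hroof₀ : E₀.roof σ q'.1 ≤ E₀.roof σ x + σ.β E₀.n * |x - q'.1| := by
    simp only [Diamond.roof]
    have : |x - E₀.c.1| ≤ |x - q'.1| + |q'.1 - E₀.c.1| := abs_sub_le _ _ _
    nlinarith [abs_nonneg (x - q'.1)]
  -- assemble: `E.roof x = E.c.2 + b - β |x - E.c.1|`
  have hmain : E.roof σ x ≤ E₀.roof σ x + 4 * σ.b E.n
      + σ.β E₀.n * (|x - E.c.1| + σ.a E.n + 2 * σ.b E.n) - σ.β E.n * |x - E.c.1| := by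
    have step : E.roof σ x ≤ q'.2 + 4 * σ.b E.n - σ.β E.n * |x - E.c.1| := by
      simp only [Diamond.roof]; linarith
    have : σ.β E₀.n * |x - q'.1| ≤ σ.β E₀.n * (|x - E.c.1| + σ.a E.n + 2 * σ.b E.n) :=
      mul_le_mul_of_nonneg_left hx' hβ₀.le
    linarith
  -- the `E₀`-slope terms are small
  have hsmall : σ.β E₀.n * (|x - E.c.1| + σ.a E.n + 2 * σ.b E.n) ≤
      σ.β E.n / 10 * |x - E.c.1| + σ.b E.n / 10 + σ.b E.n / 50 := by
    have hnn : 0 ≤ |x - E.c.1| + σ.a E.n + 2 * σ.b E.n := by positivity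
    have := mul_le_mul_of_nonneg_right hβle hnn
    nlinarith
  constructor
  · nlinarith [abs_nonneg (x - E.c.1)]
  · intro hfar
    have : 5 * σ.b E.n ≤ (σ.β E.n - σ.β E.n / 10) * |x - E.c.1| := by nlinarith
    nlinarith [abs_nonneg (x - E.c.1)]

/-- **The floor dip of an absorbed diamond** (mirror image of `exists_roof_dom`).
[cite: Hochman2025, Lemma 4.3 and Prop 4.9 (1)] -/
theorem exists_floor_dom {Λ : ℝ} (hσ : σ.Good Λ) {S : Finset Diamond} {E : Diamond}
    (hS : ∀ E' ∈ S, E.n < E'.n) (hnear : Near σ E S (2 * σ.b E.n)) :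
    ∃ E₀ ∈ S, ∀ x, E₀.floor σ x - 5 * σ.b E.n ≤ E.floor σ x ∧
      (6 * σ.a E.n ≤ |x - E.c.1| → E₀.floor σ x ≤ E.floor σ x) := by
  obtain ⟨q, hq, q', hq', hd⟩ := hnear
  obtain ⟨hd1, hd2⟩ := abs_sub_le_of_dist_le hd
  obtain ⟨⟨E₀, hE₀, hq'floor⟩, -⟩ := hq'
  refine ⟨E₀, hE₀, fun x => ?_⟩
  have hb := σ.b_pos E.n
  have ha := σ.a_pos E.n
  have hβ := σ.β_pos E.n
  have hβ₀ := σ.β_pos E₀.n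
  have hβa : σ.β E.n * σ.a E.n = σ.b E.n := σ.β_mul_a E.n
  have hβle : σ.β E₀.n ≤ σ.β E.n / 10 := hσ.β_lt_le (hS E₀ hE₀)
  have hβb : σ.β E.n * σ.b E.n ≤ σ.b E.n / 10 := hσ.β_mul_b_le E.n
  have h1 : q.2 - σ.b E.n ≤ E.c.2 := by
    have := Diamond.abs_sub_le_b hq
    rw [abs_le] at this; linarith
  have h2 : q'.2 - 2 * σ.b E.n ≤ q.2 := by rw [abs_le] at hd2; linarith
  have hqx : |q.1 - E.c.1| ≤ σ.a E.n := Diamond.abs_sub_le_a hq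
  have hx' : |x - q'.1| ≤ |x - E.c.1| + σ.a E.n + 2 * σ.b E.n := by
    have t1 : |x - q'.1| ≤ |x - E.c.1| + |E.c.1 - q'.1| := abs_sub_le _ _ _
    have t2 : |E.c.1 - q'.1| ≤ |E.c.1 - q.1| + |q.1 - q'.1| := abs_sub_le _ _ _
    rw [abs_sub_comm E.c.1 q.1] at t2
    linarith
  have hfloor₀ : E₀.floor σ x - σ.β E₀.n * |x - q'.1| ≤ E₀.floor σ q'.1 := by
    simp only [Diamond.floor]
    have : |x - E₀.c.1| ≤ |x - q'.1| + |q'.1 - E₀.c.1| := abs_sub_le _ _ _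
    nlinarith [abs_nonneg (x - q'.1)]
  have hmain : E₀.floor σ x - 4 * σ.b E.n
      - σ.β E₀.n * (|x - E.c.1| + σ.a E.n + 2 * σ.b E.n) + σ.β E.n * |x - E.c.1| ≤ E.floor σ x := by
    have step : q'.2 - 4 * σ.b E.n + σ.β E.n * |x - E.c.1| ≤ E.floor σ x := by
      simp only [Diamond.floor]; linarith
    have : σ.β E₀.n * |x - q'.1| ≤ σ.β E₀.n * (|x - E.c.1| + σ.a E.n + 2 * σ.b E.n) :=
      mul_le_mul_of_nonneg_left hx' hβ₀.le
    linarith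
  have hsmall : σ.β E₀.n * (|x - E.c.1| + σ.a E.n + 2 * σ.b E.n) ≤
      σ.β E.n / 10 * |x - E.c.1| + σ.b E.n / 10 + σ.b E.n / 50 := by
    have hnn : 0 ≤ |x - E.c.1| + σ.a E.n + 2 * σ.b E.n := by positivity
    have := mul_le_mul_of_nonneg_right hβle hnn
    nlinarith
  constructor
  · nlinarith [abs_nonneg (x - E.c.1)]
  · intro hfar
    have : 5 * σ.b E.n ≤ (σ.β E.n - σ.β E.n / 10) * |x - E.c.1| := by nlinarith
    nlinarith [abs_nonneg (x - E.c.1)]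

/-! ### Cumulative growth of a clan below a stage (Prop. 4.9 (2)) -/

/-- A member of stage `m` has level `≥ D.n - m` (the root `D` itself trivially so). [folklore] -/
theorem level_ge_of_mem_clanStage {F : Finset Diamond} {D E : Diamond} {m : ℕ}
    (hE : E ∈ clanStage σ F D m) : D.n ≤ E.n + m := by
  rcases mem_clanStage_iff_level hE with rfl | ⟨-, -, h⟩
  · exact Nat.le_add_right _ _
  · exact h

/-- **Roofs added after stage `m` are dominated** (Prop. 4.9 (2): "the cumulative vertical
height of a double jigsaw is `< hₙ + 10 h_{≤n-1}`"): every member of a later stage either was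
already present at stage `m`, or its roof lies below the roof of some stage-`m` member raised by
`6 b_L - b_{E.n}`, where `L = D.n - m - 1` is the highest level absorbed after stage `m` (the
bumps `5 b_ℓ` of the successive levels `ℓ ≤ L` sum to less than `6 b_L`).
[cite: Hochman2025, Prop 4.9 (2)] -/
theorem roof_dom_after_stage {Λ : ℝ} (hσ : σ.Good Λ) (F : Finset Diamond) (D : Diamond)
    (m : ℕ) (hm : m < D.n) (j : ℕ) :
    ∀ E ∈ clanStage σ F D (m + j), E ∈ clanStage σ F D m ∨
      (E.n + m < D.n ∧ ∃ E' ∈ clanStage σ F D m,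
        ∀ x, E.roof σ x ≤ E'.roof σ x + 6 * σ.b (D.n - m - 1) - σ.b E.n) := by
  induction j with
  | zero => intro E hE; exact Or.inl hE
  | succ j ih =>
    intro E hE
    rw [← add_assoc, clanStage_succ, Finset.mem_union] at hE
    rcases hE with hE | hE
    · exact ih E hE
    · rw [Finset.mem_filter] at hE
      obtain ⟨-, hlev, hnear⟩ := hE
      right
      refine ⟨by omega, ?_⟩
      -- dominate by a member of stage `m + j`, then by a member of stage `m`
      have hS : ∀ E' ∈ clanStage σ F D (m + j), E.n < E'.n := by
        intro E' hE'
        have := level_ge_of_mem_clanStage hE'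
        omega
      obtain ⟨E₀, hE₀, hdom⟩ := exists_roof_dom hσ hS hnear
      have hbE : 6 * σ.b E.n ≤ σ.b (D.n - m - 1) ∨ E.n = D.n - m - 1 := by
        by_cases heq : E.n = D.n - m - 1
        · exact Or.inr heq
        · left
          have hlt : E.n < D.n - m - 1 := by omega
          have := hσ.b_lt_le hlt
          linarith [σ.b_pos E.n]
      rcases ih E₀ hE₀ with hE₀m | ⟨hE₀lev, E', hE', hdom'⟩
      · refine ⟨E₀, hE₀m, fun x => ?_⟩
        have := (hdom x).1
        have hbL := σ.b_pos (D.n - m - 1)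
        rcases hbE with h6 | heq
        · linarith
        · rw [← heq]; linarith
      · refine ⟨E', hE', fun x => ?_⟩
        have h1 := (hdom x).1
        have h2 := hdom' x
        -- `E₀` entered after stage `m` at a level above `E.n`: `100 b_{E.n} ≤ b_{E₀.n}`
        have hlt : E.n < E₀.n := hS E₀ hE₀
        have h3 := hσ.b_lt_le hlt
        linarith [σ.b_pos E.n]

/-- Mirror image of `roof_dom_after_stage` for floors. [cite: Hochman2025, Prop 4.9 (2)] -/
theorem floor_dom_after_stage {Λ : ℝ} (hσ : σ.Good Λ) (F : Finset Diamond) (D : Diamond)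
    (m : ℕ) (hm : m < D.n) (j : ℕ) :
    ∀ E ∈ clanStage σ F D (m + j), E ∈ clanStage σ F D m ∨
      (E.n + m < D.n ∧ ∃ E' ∈ clanStage σ F D m,
        ∀ x, E'.floor σ x - 6 * σ.b (D.n - m - 1) + σ.b E.n ≤ E.floor σ x) := by
  induction j with
  | zero => intro E hE; exact Or.inl hE
  | succ j ih =>
    intro E hE
    rw [← add_assoc, clanStage_succ, Finset.mem_union] at hE
    rcases hE with hE | hE
    · exact ih E hE
    · rw [Finset.mem_filter] at hE
      obtain ⟨-, hlev, hnear⟩ := hE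
      right
      refine ⟨by omega, ?_⟩
      have hS : ∀ E' ∈ clanStage σ F D (m + j), E.n < E'.n := by
        intro E' hE'
        have := level_ge_of_mem_clanStage hE'
        omega
      obtain ⟨E₀, hE₀, hdom⟩ := exists_floor_dom hσ hS hnear
      have hbE : 6 * σ.b E.n ≤ σ.b (D.n - m - 1) ∨ E.n = D.n - m - 1 := by
        by_cases heq : E.n = D.n - m - 1
        · exact Or.inr heq
        · left
          have hlt : E.n < D.n - m - 1 := by omega
          have := hσ.b_lt_le hlt
          linarith [σ.b_pos E.n]
      rcases ih E₀ hE₀ with hE₀m | ⟨hE₀lev, E', hE', hdom'⟩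
      · refine ⟨E₀, hE₀m, fun x => ?_⟩
        have := (hdom x).1
        have hbL := σ.b_pos (D.n - m - 1)
        rcases hbE with h6 | heq
        · linarith
        · rw [← heq]; linarith
      · refine ⟨E', hE', fun x => ?_⟩
        have h1 := (hdom x).1
        have h2 := hdom' x
        have hlt : E.n < E₀.n := hS E₀ hE₀
        have h3 := hσ.b_lt_le hlt
        linarith [σ.b_pos E.n]

/-- **The whole clan stays within `6 b_{D.n - 1}` of its root, vertically** (Prop. 4.9 (2)):
every member's roof lies below the roof of `D` raised by `6 b_{D.n-1}`, and every member's
floor above the floor of `D` lowered by as much. [cite: Hochman2025, Prop 4.9 (2)] -/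
theorem roof_le_of_mem_clan {Λ : ℝ} (hσ : σ.Good Λ) {F : Finset Diamond} {D E : Diamond}
    (hD : 0 < D.n) (hE : E ∈ clan σ F D) (x : ℝ) :
    E.roof σ x ≤ D.roof σ x + 6 * σ.b (D.n - 1) := by
  have := roof_dom_after_stage hσ F D 0 hD D.n E (by simpa [clan] using hE)
  rcases this with h0 | ⟨-, E', hE', hdom⟩
  · rw [clanStage_zero, Finset.mem_singleton] at h0
    subst h0
    linarith [σ.b_pos (E.n - 1)]
  · rw [clanStage_zero, Finset.mem_singleton] at hE'
    subst hE'
    have := hdom x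
    simp only [Nat.sub_zero] at this
    linarith [σ.b_pos E.n]

/-- Floors of clan members lie above the lowered floor of the root (Prop. 4.9 (2)).
[cite: Hochman2025, Prop 4.9 (2)] -/
theorem floor_le_of_mem_clan {Λ : ℝ} (hσ : σ.Good Λ) {F : Finset Diamond} {D E : Diamond}
    (hD : 0 < D.n) (hE : E ∈ clan σ F D) (x : ℝ) :
    D.floor σ x - 6 * σ.b (D.n - 1) ≤ E.floor σ x := by
  have := floor_dom_after_stage hσ F D 0 hD D.n E (by simpa [clan] using hE)
  rcases this with h0 | ⟨-, E', hE', hdom⟩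
  · rw [clanStage_zero, Finset.mem_singleton] at h0
    subst h0
    linarith [σ.b_pos (E.n - 1)]
  · rw [clanStage_zero, Finset.mem_singleton] at hE'
    subst hE'
    have := hdom x
    simp only [Nat.sub_zero] at this
    linarith [σ.b_pos E.n]

/-- The clan of a level-`0` diamond is the diamond itself. [folklore] -/
theorem clan_of_level_zero {F : Finset Diamond} {D : Diamond} (hD : D.n = 0) :
    clan σ F D = {D} := by
  rw [clan, hD, clanStage_zero]

/-! ### The sandwich: the hull lies within the doubled diamonds (Prop. 4.9 (2), Prop. 4.1 (1)) -/

/-- **The envelope of a clan is a slightly inflated root diamond**: it lies between the floor of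
`D` lowered by `6 b_{D.n - 1}` and the roof of `D` raised by as much (for `D.n ≥ 1`; for
`D.n = 0` the clan is `{D}`). [cite: Hochman2025, Prop 4.9 (2)] -/
theorem env_clan_subset_infl {Λ : ℝ} (hσ : σ.Good Λ) {F : Finset Diamond} {D : Diamond}
    (hD : 0 < D.n) :
    env σ (clan σ F D) ⊆
      {q | D.floor σ q.1 - 6 * σ.b (D.n - 1) ≤ q.2 ∧ q.2 ≤ D.roof σ q.1 + 6 * σ.b (D.n - 1)} := by
  rintro q ⟨⟨E, hE, hEq⟩, ⟨E', hE', hE'q⟩⟩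
  exact ⟨(floor_le_of_mem_clan hσ hD hE q.1).trans hEq,
    hE'q.trans (roof_le_of_mem_clan hσ hD hE' q.1)⟩

/-- **Prop. 4.9 (2) in gauge form**: the envelope of the clan of `D` lies inside the doubled
diamond `2·D` (indeed inside `1.06·D`). [cite: Hochman2025, Prop 4.9 (2)] -/
theorem env_clan_subset_scaled_two {Λ : ℝ} (hσ : σ.Good Λ) {F : Finset Diamond} (D : Diamond) :
    env σ (clan σ F D) ⊆ D.scaled σ 2 := by
  rcases Nat.eq_zero_or_pos D.n with h0 | hD
  · rw [clan_of_level_zero h0, env_singleton, Diamond.toSet_eq_scaled_one]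
    exact D.scaled_mono (by norm_num)
  · intro q hq
    obtain ⟨h1, h2⟩ := env_clan_subset_infl hσ hD hq
    simp only [Diamond.scaled, mem_setOf_eq, gauge_le_iff, Prod.fst_sub, Prod.snd_sub]
    have hb := σ.b_pos D.n
    have ha := σ.a_pos D.n
    have hβa : σ.β D.n * σ.a D.n = σ.b D.n := σ.β_mul_a D.n
    have hsmall : 6 * σ.b (D.n - 1) ≤ σ.b D.n := by
      have := hσ.b_lt_le (Nat.sub_lt hD Nat.one_pos)
      linarith [σ.b_pos (D.n - 1)]
    simp only [Diamond.roof, Diamond.floor] at h1 h2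
    -- `|q.2 - c.2| ≤ 2b - β|q.1 - c.1|`, then multiply by `a`
    have h3 : |q.2 - D.c.2| ≤ 2 * σ.b D.n - σ.β D.n * |q.1 - D.c.1| := by
      rw [abs_le]; constructor <;> linarith
    have h4 := mul_le_mul_of_nonneg_left h3 ha.le
    nlinarith [abs_nonneg (q.1 - D.c.1), abs_nonneg (q.2 - D.c.2)]

/-- **The hull lies inside the union of the doubled diamonds.** [cite: Hochman2025, Prop 4.9 (2)] -/
theorem hull_subset_iUnion_scaled {Λ : ℝ} (hσ : σ.Good Λ) (F : Finset Diamond) :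
    hull σ F ⊆ ⋃ D ∈ F, D.scaled σ 2 := by
  intro q hq
  rw [mem_hull_iff] at hq
  obtain ⟨D, hD, hq⟩ := hq
  exact mem_biUnion hD (env_clan_subset_scaled_two hσ D hq)

/-- **The sandwich, left half** (Prop. 4.1 (1), for diamonds): every point outside all the
doubled diamonds `2·D`, `D ∈ F`, is safe. [cite: Hochman2025, Prop 4.1 (1)] -/
theorem compl_iUnion_scaled_subset_safe {Λ : ℝ} (hσ : σ.Good Λ) (F : Finset Diamond) :
    (⋃ D ∈ F, D.scaled σ 2)ᶜ ⊆ safe σ F :=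
  compl_subset_compl.mpr (hull_subset_iUnion_scaled hσ F)


/-! ### Widths grow hundredfold per level -/

namespace Scales.Good

variable {Λ : ℝ} (h : σ.Good Λ)
include h

/-- Widths grow at least hundredfold per level: `100 aₙ ≤ aₘ` for `n < m` (Prop. 4.9 (b):
`wₙ > 10 w_{≤n-1}`). [cite: Hochman2025, Prop 4.9 (b)] -/
theorem a_lt_le' {n m : ℕ} (hnm : n < m) : 100 * σ.a n ≤ σ.a m := by
  have step : ∀ k, 100 * σ.a k ≤ σ.a (k + 1) := by
    intro k
    have h1 := h.sep k
    have h2 := h.flat (k + 1)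
    have hΛ := h.ten_le
    have ha := σ.a_pos k
    have hΛ2 : (100 : ℝ) ≤ Λ * Λ := by nlinarith
    calc 100 * σ.a k ≤ Λ * (Λ * σ.a k) := by
          nlinarith [mul_nonneg (sub_nonneg.mpr hΛ2) ha.le]
      _ ≤ Λ * σ.b (k + 1) := by nlinarith [h.pos]
      _ ≤ σ.a (k + 1) := h2
  have key : ∀ k, 100 * σ.a n ≤ σ.a (n + 1 + k) := by
    intro k
    induction k with
    | zero => exact step n
    | succ k ih =>
      have := step (n + 1 + k)
      rw [show n + 1 + (k + 1) = n + 1 + k + 1 by ring]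
      nlinarith [σ.a_pos (n + 1 + k)]
  obtain ⟨k, rfl⟩ := Nat.exists_eq_add_of_lt hnm
  have := key k
  rwa [show n + 1 + k = n + k + 1 by ring] at this

/-- Widths are monotone in the level. [folklore] -/
theorem a_mono {n m : ℕ} (hnm : n ≤ m) : σ.a n ≤ σ.a m := by
  rcases hnm.lt_or_eq with hlt | rfl
  · have := h.a_lt_le' hlt
    nlinarith [σ.a_pos n]
  · exact le_rfl

end Scales.Good

/-! ### One absorption level: where the new points of the envelope are (Prop. 4.9 (1)) -/

/-- **Structure of one level of absorption** (Prop. 4.9 (1): "(J ⋉ D) ∖ J is properly contained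
in a rectangle of dimensions `5wₙ × 5hₙ` that contains `D`"): if `A` is a set of level-`n`
diamonds, each within its height of the envelope of a set `S` of higher-level diamonds, then a
point of `env (S ∪ A)` which is not in `env S` lies within `6aₙ` (horizontally) of the centre of
some `E ∈ A` and either just above all the roofs of `S` and below the roof of `E` (which exceeds
the roof of a member of `S` by at most `5bₙ`), or symmetrically below.
[cite: Hochman2025, Prop 4.9 (1)] -/
theorem mem_env_union_structure {Λ : ℝ} (hσ : σ.Good Λ) {S A : Finset Diamond} {n : ℕ}
    (hA : ∀ E ∈ A, E.n = n) (hS : ∀ E' ∈ S, n < E'.n) (hnear : ∀ E ∈ A, Near σ E S (2 * σ.b n))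
    {q : ℝ × ℝ} (hq : q ∈ env σ (S ∪ A)) (hqS : q ∉ env σ S) :
    ∃ E ∈ A, |q.1 - E.c.1| < 6 * σ.a n ∧ ∃ E₀ ∈ S,
      ((∀ E'' ∈ S, E''.roof σ q.1 < q.2) ∧ q.2 ≤ E.roof σ q.1 ∧
          ∀ x, E.roof σ x ≤ E₀.roof σ x + 5 * σ.b n) ∨
      ((∀ E'' ∈ S, q.2 < E''.floor σ q.1) ∧ E.floor σ q.1 ≤ q.2 ∧
          ∀ x, E₀.floor σ x - 5 * σ.b n ≤ E.floor σ x) := by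
  obtain ⟨⟨F₁, hF₁, hfl⟩, ⟨F₂, hF₂, hro⟩⟩ := hq
  rw [mem_env, not_and_or] at hqS
  by_cases hcase : ∃ E'' ∈ S, E''.floor σ q.1 ≤ q.2
  · -- then no roof of `S` is above `q`, and the roof above `q` comes from `A`
    have hroofs : ∀ E'' ∈ S, E''.roof σ q.1 < q.2 := by
      rcases hqS with h | h
      · exact absurd hcase h
      · intro E'' hE''
        by_contra hle
        push Not at hle
        exact h ⟨E'', hE'', hle⟩
    have hF₂A : F₂ ∈ A := by
      rcases Finset.mem_union.mp hF₂ with h | h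
      · exact absurd hro (not_le.mpr (hroofs F₂ h))
      · exact h
    have hn : F₂.n = n := hA F₂ hF₂A
    have hS' : ∀ E' ∈ S, F₂.n < E'.n := fun E' hE' => hn ▸ hS E' hE'
    obtain ⟨E₀, hE₀, hdom⟩ := exists_roof_dom hσ hS' (hn ▸ hnear F₂ hF₂A)
    refine ⟨F₂, hF₂A, ?_, E₀, hE₀, Or.inl ⟨hroofs, hro, fun x => hn ▸ (hdom x).1⟩⟩
    by_contra hfar
    push Not at hfar
    have h1 := (hdom q.1).2 (hn ▸ hfar)
    have h2 := hroofs E₀ hE₀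
    linarith
  · push Not at hcase
    have hF₁A : F₁ ∈ A := by
      rcases Finset.mem_union.mp hF₁ with h | h
      · exact absurd hfl (not_le.mpr (hcase F₁ h))
      · exact h
    have hn : F₁.n = n := hA F₁ hF₁A
    have hS' : ∀ E' ∈ S, F₁.n < E'.n := fun E' hE' => hn ▸ hS E' hE'
    obtain ⟨E₀, hE₀, hdom⟩ := exists_floor_dom hσ hS' (hn ▸ hnear F₁ hF₁A)
    refine ⟨F₁, hF₁A, ?_, E₀, hE₀, Or.inr ⟨hcase, hfl, fun x => hn ▸ (hdom x).1⟩⟩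
    by_contra hfar
    push Not at hfar
    have h1 := (hdom q.1).2 (hn ▸ hfar)
    have h2 := hcase E₀ hE₀
    linarith

/-- **One level of absorption moves the envelope by at most `7.2 aₙ`** (sup-metric): every
point of `env (S ∪ A)` is within `36/5 · aₙ` of a point of `env S`.
[cite: Hochman2025, Prop 4.9 (1)–(2)] -/
theorem exists_near_of_mem_env_union {Λ : ℝ} (hσ : σ.Good Λ) {S A : Finset Diamond} {n : ℕ}
    (hA : ∀ E ∈ A, E.n = n) (hS : ∀ E' ∈ S, n < E'.n) (hnear : ∀ E ∈ A, Near σ E S (2 * σ.b n))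
    {q : ℝ × ℝ} (hq : q ∈ env σ (S ∪ A)) :
    ∃ q' ∈ env σ S, dist q q' ≤ 36 / 5 * σ.a n := by
  by_cases hqS : q ∈ env σ S
  · exact ⟨q, hqS, by rw [dist_self]; have := σ.a_pos n; positivity⟩
  obtain ⟨E, hEA, hEx, E₀, -, hcases⟩ := mem_env_union_structure hσ hA hS hnear hq hqS
  have hn : E.n = n := hA E hEA
  obtain ⟨e, he, e', he', hd⟩ := hnear E hEA
  obtain ⟨hd1, hd2⟩ := abs_sub_le_of_dist_le hd
  have ha := σ.a_pos n
  have hb := σ.b_pos n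
  have hbn : σ.b n ≤ σ.a n / 10 := hσ.b_le n
  refine ⟨e', he', ?_⟩
  -- horizontal distance
  have hex : |e.1 - E.c.1| ≤ σ.a n := hn ▸ Diamond.abs_sub_le_a he
  have hey : |e.2 - E.c.2| ≤ σ.b n := hn ▸ Diamond.abs_sub_le_b he
  have hx : |q.1 - e'.1| ≤ 7 * σ.a n + 2 * σ.b n := by
    have t1 : |q.1 - e'.1| ≤ |q.1 - E.c.1| + |E.c.1 - e'.1| := abs_sub_le _ _ _
    have t2 : |E.c.1 - e'.1| ≤ |E.c.1 - e.1| + |e.1 - e'.1| := abs_sub_le _ _ _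
    rw [abs_sub_comm E.c.1 e.1] at t2
    linarith
  -- vertical distance, through the members of `S` above/below `e'`
  obtain ⟨⟨G₁, hG₁, hG₁e⟩, ⟨G₂, hG₂, hG₂e⟩⟩ := he'
  have hβ₁ : σ.β G₁.n ≤ σ.β n / 10 := hσ.β_lt_le (hS G₁ hG₁)
  have hβ₂ : σ.β G₂.n ≤ σ.β n / 10 := hσ.β_lt_le (hS G₂ hG₂)
  have hβa : σ.β n * σ.a n = σ.b n := σ.β_mul_a n
  have hβb : σ.β n * σ.b n ≤ σ.b n / 10 := hσ.β_mul_b_le n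
  have hy : |q.2 - e'.2| ≤ 4 * σ.b n := by
    rw [abs_le] at hey hd2
    rcases hcases with ⟨hroofs, hro, -⟩ | ⟨hfloors, hfl, -⟩
    · -- `q.2 ≤ roof_E(q.1) ≤ top_E ≤ e.2 + 2b ≤ e'.2 + 4b`, `q.2 > roof_{G₂}(q.1) ≥ e'.2 - ε`
      have up : q.2 ≤ e'.2 + 4 * σ.b n := by
        have : E.roof σ q.1 ≤ E.c.2 + σ.b n := by
          simp only [Diamond.roof, hn]; nlinarith [abs_nonneg (q.1 - E.c.1), σ.β_pos n]
        linarith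
      have dn : e'.2 - σ.b n ≤ q.2 := by
        have h1 := hroofs G₂ hG₂
        have h2 : G₂.roof σ e'.1 ≤ G₂.roof σ q.1 + σ.β G₂.n * |q.1 - e'.1| := by
          simp only [Diamond.roof]
          have : |q.1 - G₂.c.1| ≤ |q.1 - e'.1| + |e'.1 - G₂.c.1| := abs_sub_le _ _ _
          nlinarith [σ.β_pos G₂.n, abs_nonneg (q.1 - e'.1)]
        have h3 : σ.β G₂.n * |q.1 - e'.1| ≤ σ.β n / 10 * (7 * σ.a n + 2 * σ.b n) := by
          have := mul_le_mul hβ₂ hx (abs_nonneg _) (div_nonneg (σ.β_pos n).le (by norm_num))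
          linarith
        nlinarith
      rw [abs_le]; constructor <;> linarith
    · have dn : e'.2 - 4 * σ.b n ≤ q.2 := by
        have : E.c.2 - σ.b n ≤ E.floor σ q.1 := by
          simp only [Diamond.floor, hn]; nlinarith [abs_nonneg (q.1 - E.c.1), σ.β_pos n]
        linarith
      have up : q.2 ≤ e'.2 + σ.b n := by
        have h1 := hfloors G₁ hG₁
        have h2 : G₁.floor σ q.1 ≤ G₁.floor σ e'.1 + σ.β G₁.n * |q.1 - e'.1| := by
          simp only [Diamond.floor]
          have : |q.1 - G₁.c.1| ≤ |q.1 - e'.1| + |e'.1 - G₁.c.1| := abs_sub_le _ _ _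
          nlinarith [σ.β_pos G₁.n, abs_nonneg (q.1 - e'.1)]
        have h3 : σ.β G₁.n * |q.1 - e'.1| ≤ σ.β n / 10 * (7 * σ.a n + 2 * σ.b n) := by
          have := mul_le_mul hβ₁ hx (abs_nonneg _) (div_nonneg (σ.β_pos n).le (by norm_num))
          linarith
        nlinarith
      rw [abs_le]; constructor <;> linarith
  rw [Prod.dist_eq, Real.dist_eq, Real.dist_eq, max_le_iff]
  constructor <;> nlinarith

/-- **The envelope of a clan moves by at most `7.4 a_L` after stage `m`** (`L = D.n - m - 1`,
the highest level absorbed after stage `m`; Prop. 4.9 (2): "extended by at most `5hₙ` upwards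
and downwards, and `5wₙ` left and right, in the course of stage `n`"): every point of the
envelope of a later stage is a point of the stage-`m` envelope or within `37/5·a_L - a_ℓ/5` of
one, `ℓ` the lowest level reached. [cite: Hochman2025, Prop 4.9 (2)] -/
theorem exists_near_of_mem_env_clanStage {Λ : ℝ} (hσ : σ.Good Λ) (F : Finset Diamond)
    (D : Diamond) (m j : ℕ) (hmj : m + j ≤ D.n) :
    ∀ q ∈ env σ (clanStage σ F D (m + j)), q ∈ env σ (clanStage σ F D m) ∨
      ∃ q' ∈ env σ (clanStage σ F D m),
        dist q q' ≤ 37 / 5 * σ.a (D.n - m - 1) - σ.a (D.n - m - j) / 5 := by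
  induction j with
  | zero => intro q hq; exact Or.inl hq
  | succ j ih =>
    intro q hq
    have hmj' : m + j ≤ D.n := by omega
    -- one level: `S = stage (m+j)`, `A` = the level-`n` diamonds absorbed, `n = D.n - (m+j+1)`
    set n := D.n - (m + j + 1) with hn
    rw [← add_assoc, clanStage_succ] at hq
    have hA : ∀ E ∈ F.filter (fun E => E.n + (m + j + 1) = D.n ∧
        Near σ E (clanStage σ F D (m + j)) (2 * σ.b E.n)), E.n = n := by
      intro E hE; have := (Finset.mem_filter.mp hE).2.1; omega
    have hS : ∀ E' ∈ clanStage σ F D (m + j), n < E'.n := by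
      intro E' hE'; have := level_ge_of_mem_clanStage hE'; omega
    have hnear : ∀ E ∈ F.filter (fun E => E.n + (m + j + 1) = D.n ∧
        Near σ E (clanStage σ F D (m + j)) (2 * σ.b E.n)),
        Near σ E (clanStage σ F D (m + j)) (2 * σ.b n) := by
      intro E hE
      have h := (Finset.mem_filter.mp hE).2.2
      rwa [hA E hE] at h
    obtain ⟨q₁, hq₁, hd₁⟩ := exists_near_of_mem_env_union hσ hA hS hnear hq
    have han : σ.a n ≤ σ.a (D.n - m - 1) := hσ.a_mono (by omega)
    have ha := σ.a_pos n
    rcases ih hmj' q₁ hq₁ with hq₁m | ⟨q₂, hq₂, hd₂⟩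
    · right
      refine ⟨q₁, hq₁m, ?_⟩
      have : D.n - m - (j + 1) = n := by omega
      rw [this]
      linarith
    · right
      refine ⟨q₂, hq₂, ?_⟩
      have hlev : D.n - m - j = n + 1 := by omega
      rw [hlev] at hd₂
      have hgrow : 100 * σ.a n ≤ σ.a (n + 1) := hσ.a_lt_le' (Nat.lt_succ_self n)
      have : D.n - m - (j + 1) = n := by omega
      rw [this]
      linarith [dist_triangle q q₁ q₂]

/-- **The envelope of a clan lies within `7.4 a_{D.n-1}` of its root diamond** (sup-metric).
[cite: Hochman2025, Prop 4.9 (2)] -/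
theorem exists_near_root_of_mem_env_clan {Λ : ℝ} (hσ : σ.Good Λ) (F : Finset Diamond)
    {D : Diamond} {q : ℝ × ℝ} (hq : q ∈ env σ (clan σ F D)) :
    ∃ q' ∈ D.toSet σ, dist q q' ≤ 37 / 5 * σ.a (D.n - 1) := by
  have := exists_near_of_mem_env_clanStage hσ F D 0 D.n (by omega) q (by simpa [clan] using hq)
  rw [clanStage_zero, env_singleton] at this
  rcases this with h | ⟨q', hq', hd⟩
  · exact ⟨q, h, by rw [dist_self]; have := σ.a_pos (D.n - 1); positivity⟩
  · simp only [Nat.sub_zero, Nat.sub_self] at hd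
    exact ⟨q', hq', by linarith [σ.a_pos 0]⟩

/-- The clan of `D` and the stage just after level `n` has been absorbed.
[folklore] -/
theorem exists_near_stage_of_mem_env_clan {Λ : ℝ} (hσ : σ.Good Λ) (F : Finset Diamond)
    (D : Diamond) {m : ℕ} (hm : m ≤ D.n) {q : ℝ × ℝ} (hq : q ∈ env σ (clan σ F D)) :
    q ∈ env σ (clanStage σ F D m) ∨
      ∃ q' ∈ env σ (clanStage σ F D m), dist q q' ≤ 37 / 5 * σ.a (D.n - m - 1) := by
  have := exists_near_of_mem_env_clanStage hσ F D m (D.n - m) (by omega) q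
    (by rw [Nat.add_sub_cancel' hm]; simpa [clan] using hq)
  rcases this with h | ⟨q', hq', hd⟩
  · exact Or.inl h
  · simp only [Nat.sub_self] at hd
    exact Or.inr ⟨q', hq', by linarith [σ.a_pos (D.n - m - (D.n - m)), σ.a_pos 0]⟩

/-! ### Separation of the pieces (Prop. 4.9 (3)) -/

/-- **A non-absorbed diamond of level `n` stays `1.9 bₙ` away from the envelope after level `n`
is absorbed** (the heart of Prop. 4.9 (3), "the double jigsaws in `H` are pairwise disjoint"):
with `S`, `A` as in `mem_env_union_structure`, `A ⊆ F` and `F` `21`-sparse (Hochman's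
`20`-sparse), a level-`n` diamond `D₁ ∈ F ∖ A` which is NOT within its height of `env S` is at
sup-distance `> 19/10 · bₙ` from `env (S ∪ A)`: a new point near `D₁` would come from a level-`n`
bump `E ∈ A` with `|Δx| ≤ 7.2 aₙ`, `|Δy| ≤ 8.9 bₙ` from `D₁`, against sparsity.
[cite: Hochman2025, Prop 4.9 (3)] -/
theorem far_of_not_near {Λ : ℝ} (hσ : σ.Good Λ) {F : Finset Diamond} (hF : IsSparse σ F 21)
    {S A : Finset Diamond} {n : ℕ} (hAF : A ⊆ F) (hA : ∀ E ∈ A, E.n = n)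
    (hS : ∀ E' ∈ S, n < E'.n) (hnear : ∀ E ∈ A, Near σ E S (2 * σ.b n))
    {D₁ : Diamond} (hD₁F : D₁ ∈ F) (hD₁n : D₁.n = n) (hD₁A : D₁ ∉ A)
    (hfar : ¬ Near σ D₁ S (2 * σ.b n)) :
    ∀ p ∈ D₁.toSet σ, ∀ q ∈ env σ (S ∪ A), 19 / 10 * σ.b n < dist p q := by
  intro p hp q hq
  by_contra hd
  push Not at hd
  have ha := σ.a_pos n
  have hb := σ.b_pos n
  have hbn : σ.b n ≤ σ.a n / 10 := hσ.b_le n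
  by_cases hqS : q ∈ env σ S
  · exact hfar ⟨p, hp, q, hqS, by linarith⟩
  obtain ⟨E, hEA, hEx, E₀, hE₀, hcases⟩ := mem_env_union_structure hσ hA hS hnear hq hqS
  have hn : E.n = n := hA E hEA
  have hne : D₁ ≠ E := fun h => hD₁A (h ▸ hEA)
  have hsparse := hF D₁ hD₁F E (hAF hEA) hne (by rw [hD₁n, hn])
  rw [hD₁n, le_gauge_iff] at hsparse
  simp only [Prod.fst_sub, Prod.snd_sub] at hsparse
  obtain ⟨hd1, hd2⟩ := abs_sub_le_of_dist_le hd
  have hpx : |p.1 - D₁.c.1| ≤ σ.a n := hD₁n ▸ Diamond.abs_sub_le_a hp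
  have hpy : |p.2 - D₁.c.2| ≤ σ.b n := hD₁n ▸ Diamond.abs_sub_le_b hp
  -- horizontal
  have hΔx : |D₁.c.1 - E.c.1| ≤ 7 * σ.a n + 19 / 10 * σ.b n := by
    have t1 : |D₁.c.1 - E.c.1| ≤ |D₁.c.1 - p.1| + |p.1 - E.c.1| := abs_sub_le _ _ _
    have t2 : |p.1 - E.c.1| ≤ |p.1 - q.1| + |q.1 - E.c.1| := abs_sub_le _ _ _
    rw [abs_sub_comm D₁.c.1 p.1] at t1
    linarith
  -- vertical
  have hβ₀ : σ.β E₀.n ≤ σ.β n / 10 := hσ.β_lt_le (hS E₀ hE₀)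
  have hβa : σ.β n * σ.a n = σ.b n := σ.β_mul_a n
  have hΔy : |D₁.c.2 - E.c.2| ≤ 89 / 10 * σ.b n := by
    rw [abs_le] at hpy hd2
    rcases hcases with ⟨hroofs, hro, hdom⟩ | ⟨hfloors, hfl, hdom⟩
    · have hU := hroofs E₀ hE₀
      -- `E.c.2 ≥ q.2 - b`
      have h1 : q.2 - σ.b n ≤ E.c.2 := by
        have : E.roof σ q.1 ≤ E.c.2 + σ.b n := by
          simp only [Diamond.roof, hn]; nlinarith [abs_nonneg (q.1 - E.c.1), σ.β_pos n]
        linarith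
      -- `top_E ≤ roof_{E₀}(E.c.1) + 5b ≤ roof_{E₀}(q.1) + 5.6 b`
      have h2 : E.c.2 + σ.b n ≤ E₀.roof σ q.1 + 56 / 10 * σ.b n := by
        have t := hdom E.c.1
        simp only [Diamond.roof, hn, sub_self, abs_zero, mul_zero, sub_zero] at t
        have t2 : E₀.roof σ E.c.1 ≤ E₀.roof σ q.1 + σ.β E₀.n * |q.1 - E.c.1| := by
          simp only [Diamond.roof]
          have : |q.1 - E₀.c.1| ≤ |q.1 - E.c.1| + |E.c.1 - E₀.c.1| := abs_sub_le _ _ _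
          nlinarith [mul_le_mul_of_nonneg_left this (σ.β_pos E₀.n).le]
        have t3 : σ.β E₀.n * |q.1 - E.c.1| ≤ σ.β n / 10 * (6 * σ.a n) := by
          have := mul_le_mul hβ₀ hEx.le (abs_nonneg _) (div_nonneg (σ.β_pos n).le (by norm_num))
          linarith
        have t4 : σ.β n / 10 * (6 * σ.a n) = 3 / 5 * σ.b n := by rw [← hβa]; ring
        simp only [Diamond.roof] at t2 ⊢
        linarith
      -- `q.2 ≤ roof_E(q.1) ≤ roof_{E₀}(q.1) + 5b`
      have h3 : q.2 ≤ E₀.roof σ q.1 + 5 * σ.b n := le_trans hro (hdom q.1)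
      rw [abs_le]; constructor <;> linarith
    · have hL := hfloors E₀ hE₀
      have h1 : E.c.2 ≤ q.2 + σ.b n := by
        have : E.c.2 - σ.b n ≤ E.floor σ q.1 := by
          simp only [Diamond.floor, hn]; nlinarith [abs_nonneg (q.1 - E.c.1), σ.β_pos n]
        linarith
      have h2 : E₀.floor σ q.1 - 56 / 10 * σ.b n ≤ E.c.2 - σ.b n := by
        have t := hdom E.c.1
        simp only [Diamond.floor, hn, sub_self, abs_zero, mul_zero, add_zero] at t
        have t2 : E₀.floor σ q.1 - σ.β E₀.n * |q.1 - E.c.1| ≤ E₀.floor σ E.c.1 := by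
          simp only [Diamond.floor]
          have : |q.1 - E₀.c.1| ≤ |q.1 - E.c.1| + |E.c.1 - E₀.c.1| := abs_sub_le _ _ _
          nlinarith [mul_le_mul_of_nonneg_left this (σ.β_pos E₀.n).le]
        have t3 : σ.β E₀.n * |q.1 - E.c.1| ≤ σ.β n / 10 * (6 * σ.a n) := by
          have := mul_le_mul hβ₀ hEx.le (abs_nonneg _) (div_nonneg (σ.β_pos n).le (by norm_num))
          linarith
        have t4 : σ.β n / 10 * (6 * σ.a n) = 3 / 5 * σ.b n := by rw [← hβa]; ring
        simp only [Diamond.floor] at t2 ⊢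
        linarith
      have h3 : E₀.floor σ q.1 - 5 * σ.b n ≤ q.2 := le_trans (hdom q.1) hfl
      rw [abs_le]; constructor <;> linarith
  -- against sparsity: `b|Δx| + a|Δy| < 21 a b`
  nlinarith [mul_le_mul_of_nonneg_left hΔx hb.le, mul_le_mul_of_nonneg_left hΔy ha.le,
    mul_le_mul_of_nonneg_left hbn hb.le, mul_pos ha hb]

/-- Non-membership in the clan of a higher-level diamond means: not within height of the
envelope of the stage just above one's own level. [cite: Hochman2025, Def 4.8] -/
theorem not_near_of_not_mem_clan {F : Finset Diamond} {D₁ D₂ : Diamond} (hD₁F : D₁ ∈ F)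
    (hlt : D₁.n < D₂.n) (hnot : D₁ ∉ clan σ F D₂) :
    ¬ Near σ D₁ (clanStage σ F D₂ (D₂.n - D₁.n - 1)) (2 * σ.b D₁.n) := by
  intro hnear
  apply hnot
  have hstage : D₁ ∈ clanStage σ F D₂ (D₂.n - D₁.n - 1 + 1) := by
    rw [clanStage_succ, Finset.mem_union, Finset.mem_filter]
    exact Or.inr ⟨hD₁F, by omega, hnear⟩
  exact clanStage_subset_of_le F D₂ (by omega) hstage

/-- **Separation of pieces of different levels** (Prop. 4.9 (3)): if `D₁ ∈ F` of level `n` is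
not absorbed into the clan of `D₂ ∈ F` of higher level, then the envelopes of the two clans are
at sup-distance `> bₙ / 4` (the `1.9 bₙ` of `far_of_not_near` minus the `7.4 a_{n-1} ≤ 0.74 bₙ`
by which each envelope still moves at the levels below `n`). [cite: Hochman2025, Prop 4.9 (3)] -/
theorem sep_of_not_mem_clan {Λ : ℝ} (hσ : σ.Good Λ) {F : Finset Diamond} (hF : IsSparse σ F 21)
    {D₁ D₂ : Diamond} (hD₁F : D₁ ∈ F) (hlt : D₁.n < D₂.n) (hnot : D₁ ∉ clan σ F D₂) :
    ∀ q₁ ∈ env σ (clan σ F D₁), ∀ q₂ ∈ env σ (clan σ F D₂), σ.b D₁.n / 4 < dist q₁ q₂ := by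
  intro q₁ hq₁ q₂ hq₂
  set n := D₁.n with hn
  set m := D₂.n - n - 1 with hm
  have hb := σ.b_pos n
  -- the stage of `clan D₂` at which level `n` is absorbed
  have hfar := not_near_of_not_mem_clan hD₁F hlt hnot
  rw [← hm] at hfar
  have hA : ∀ E ∈ F.filter (fun E => E.n + (m + 1) = D₂.n ∧
      Near σ E (clanStage σ F D₂ m) (2 * σ.b E.n)), E.n = n := by
    intro E hE; have := (Finset.mem_filter.mp hE).2.1; omega
  have hS : ∀ E' ∈ clanStage σ F D₂ m, n < E'.n := by
    intro E' hE'; have := level_ge_of_mem_clanStage hE'; omega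
  have hnear : ∀ E ∈ F.filter (fun E => E.n + (m + 1) = D₂.n ∧
      Near σ E (clanStage σ F D₂ m) (2 * σ.b E.n)),
      Near σ E (clanStage σ F D₂ m) (2 * σ.b n) := by
    intro E hE
    have h := (Finset.mem_filter.mp hE).2.2
    rwa [hA E hE] at h
  have hD₁A : D₁ ∉ F.filter (fun E => E.n + (m + 1) = D₂.n ∧
      Near σ E (clanStage σ F D₂ m) (2 * σ.b E.n)) := by
    intro h
    exact hfar (Finset.mem_filter.mp h).2.2
  have key : ∀ p ∈ D₁.toSet σ, ∀ q ∈ env σ (clanStage σ F D₂ (m + 1)), 19 / 10 * σ.b n < dist p q := by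
    intro p hp q hq
    rw [clanStage_succ] at hq
    exact far_of_not_near hσ hF (Finset.filter_subset _ _) hA hS hnear hD₁F rfl hD₁A hfar p hp q hq
  -- move `q₂` back to stage `m + 1` and `q₁` back to `D₁` (each by `≤ 7.4 a_{n-1} ≤ 0.74 bₙ`)
  have han : ∀ k, k < n → 37 / 5 * σ.a k ≤ 37 / 50 * σ.b n := by
    intro k hk
    have := hσ.a_lt_le hk
    linarith
  have h₂ : ∃ q₂' ∈ env σ (clanStage σ F D₂ (m + 1)), dist q₂ q₂' ≤ 37 / 50 * σ.b n := by
    rcases Nat.eq_zero_or_pos n with h0 | hpos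
    · refine ⟨q₂, ?_, by simp; positivity⟩
      have : m + 1 = D₂.n := by omega
      rw [this]
      simpa [clan] using hq₂
    · rcases exists_near_stage_of_mem_env_clan hσ F D₂ (m := m + 1) (by omega) hq₂ with
        h | ⟨q', hq', hd⟩
      · exact ⟨q₂, h, by simp; positivity⟩
      · refine ⟨q', hq', hd.trans ?_⟩
        exact han _ (by omega)
  have h₁ : ∃ q₁' ∈ D₁.toSet σ, dist q₁ q₁' ≤ 37 / 50 * σ.b n := by
    rcases Nat.eq_zero_or_pos n with h0 | hpos
    · refine ⟨q₁, ?_, by simp; positivity⟩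
      have : clan σ F D₁ = {D₁} := clan_of_level_zero (by omega)
      rw [this, env_singleton] at hq₁
      exact hq₁
    · obtain ⟨q', hq', hd⟩ := exists_near_root_of_mem_env_clan hσ F (D := D₁) hq₁
      exact ⟨q', hq', hd.trans (han _ (by omega))⟩
  obtain ⟨q₂', hq₂', hd₂⟩ := h₂
  obtain ⟨q₁', hq₁', hd₁⟩ := h₁
  have hkey := key q₁' hq₁' q₂' hq₂'
  have t1 := dist_triangle q₁' q₁ q₂'
  have t2 := dist_triangle q₁ q₂ q₂'
  rw [dist_comm q₁' q₁] at t1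
  linarith

/-! ### Roots: the hull is the union of the envelopes of the non-absorbed clans -/

/-- An absorbed member of a clan (other than the root) sits at the stage indexed by the level
difference. [folklore] -/
theorem mem_clanStage_of_mem_clan {F : Finset Diamond} {D E : Diamond} (hE : E ∈ clan σ F D)
    (hne : E ≠ D) : E ∈ clanStage σ F D (D.n - E.n) ∧ E.n < D.n := by
  have hlt : E.n < D.n := level_lt_of_mem_clan hE hne
  refine ⟨?_, hlt⟩
  suffices h : ∀ m, E ∈ clanStage σ F D m → E ∈ clanStage σ F D (D.n - E.n) from h _ hE
  intro m
  induction m with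
  | zero =>
    intro h0
    rw [clanStage_zero, Finset.mem_singleton] at h0
    exact absurd h0 hne
  | succ m ih =>
    intro hm
    rw [clanStage_succ, Finset.mem_union] at hm
    rcases hm with hm | hm
    · exact ih hm
    · have hlev : E.n + (m + 1) = D.n := (Finset.mem_filter.mp hm).2.1
      have : D.n - E.n = m + 1 := by omega
      rw [this, clanStage_succ, Finset.mem_union]
      exact Or.inr hm

/-- **Clans are transitive**: the clan of a member is contained in the clan.
[cite: Hochman2025, Def 4.8] -/
theorem clan_subset_clan_of_mem {F : Finset Diamond} {D E : Diamond} (hE : E ∈ clan σ F D) :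
    clan σ F E ⊆ clan σ F D := by
  by_cases hne : E = D
  · subst hne; exact Finset.Subset.refl _
  obtain ⟨hst, hlt⟩ := mem_clanStage_of_mem_clan hE hne
  have hsub := clanStage_subset_of_mem hst (by omega) E.n
  exact fun E' hE' => clanStage_subset_of_le F D (by omega) (hsub hE')

/-- A **root** of the family `F`: a member absorbed into no other clan (Hochman's diamonds
"added in step (a)" of Def. 4.8, which start the double jigsaws of the hull).
[cite: Hochman2025, Def 4.8 (a)] -/
def IsRoot (σ : Scales) (F : Finset Diamond) (D : Diamond) : Prop :=
  D ∈ F ∧ ∀ D' ∈ F, D ∈ clan σ F D' → D' = D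

/-- Every member of the family is absorbed into the clan of some root (a clan containing it of
maximal level). [cite: Hochman2025, Def 4.8] -/
theorem exists_root_of_mem {F : Finset Diamond} {E : Diamond} (hE : E ∈ F) :
    ∃ D, IsRoot σ F D ∧ E ∈ clan σ F D := by
  set T := F.filter fun D => E ∈ clan σ F D with hT
  have hTne : T.Nonempty := ⟨E, Finset.mem_filter.mpr ⟨hE, self_mem_clan F E⟩⟩
  obtain ⟨D, hDT, hmax⟩ := T.exists_max_image (fun D => D.n) hTne
  obtain ⟨hDF, hED⟩ := Finset.mem_filter.mp hDT
  refine ⟨D, ⟨hDF, fun D' hD'F hDD' => ?_⟩, hED⟩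
  by_contra hne
  have hlt : D.n < D'.n := level_lt_of_mem_clan hDD' (Ne.symm hne)
  have hED' : E ∈ clan σ F D' := clan_subset_clan_of_mem hDD' hED
  have := hmax D' (Finset.mem_filter.mpr ⟨hD'F, hED'⟩)
  omega

/-- **The hull is the union of the envelopes of the clans of the roots.**
[cite: Hochman2025, Def 4.8] -/
theorem mem_hull_iff_exists_root {F : Finset Diamond} {q : ℝ × ℝ} :
    q ∈ hull σ F ↔ ∃ D, IsRoot σ F D ∧ q ∈ env σ (clan σ F D) := by
  rw [mem_hull_iff]
  constructor
  · rintro ⟨E, hE, hq⟩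
    obtain ⟨D, hD, hED⟩ := exists_root_of_mem hE
    exact ⟨D, hD, env_mono (clan_subset_clan_of_mem hED) hq⟩
  · rintro ⟨D, hD, hq⟩
    exact ⟨D, hD.1, hq⟩

/-- A safe point is a point outside the envelopes of the clans of the roots. [folklore] -/
theorem mem_safe_iff_forall_root {F : Finset Diamond} {q : ℝ × ℝ} :
    q ∈ safe σ F ↔ ∀ D, IsRoot σ F D → q ∉ env σ (clan σ F D) := by
  rw [safe, mem_compl_iff, mem_hull_iff_exists_root]
  simp only [not_exists, not_and]

/-- Distinct roots are not absorbed into one another. [folklore] -/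
theorem IsRoot.not_mem_clan {F : Finset Diamond} {D D' : Diamond} (hD : IsRoot σ F D)
    (hD' : D' ∈ F) (hne : D' ≠ D) : D ∉ clan σ F D' :=
  fun h => hne (hD.2 D' hD' h)

/-! ### Separation of pieces of the same level, and of distinct roots -/

/-- **Pieces of the same level are far apart** (`21`-sparsity): the envelopes of the clans of
two distinct diamonds of the same level `n` are at sup-distance `> 8 bₙ` (indeed `> 13 bₙ`).
[cite: Hochman2025, Prop 4.9 (3)] -/
theorem sep_of_level_eq {Λ : ℝ} (hσ : σ.Good Λ) {F : Finset Diamond} (hF : IsSparse σ F 21)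
    {D₁ D₂ : Diamond} (hD₁ : D₁ ∈ F) (hD₂ : D₂ ∈ F) (hne : D₁ ≠ D₂) (hn : D₁.n = D₂.n) :
    ∀ q₁ ∈ env σ (clan σ F D₁), ∀ q₂ ∈ env σ (clan σ F D₂), 8 * σ.b D₁.n < dist q₁ q₂ := by
  intro q₁ hq₁ q₂ hq₂
  set n := D₁.n with hn₁
  have ha := σ.a_pos n
  have hb := σ.b_pos n
  have hbn : σ.b n ≤ σ.a n / 10 := hσ.b_le n
  -- back to the root diamonds
  have han : ∀ k, k < n → 37 / 5 * σ.a k ≤ 37 / 50 * σ.b n := by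
    intro k hk; have := hσ.a_lt_le hk; linarith
  have back : ∀ {D : Diamond} {q : ℝ × ℝ}, D.n = n → q ∈ env σ (clan σ F D) →
      ∃ p ∈ D.toSet σ, dist q p ≤ 37 / 50 * σ.b n := by
    intro D q hDn hq
    rcases Nat.eq_zero_or_pos n with h0 | hpos
    · refine ⟨q, ?_, by rw [dist_self]; positivity⟩
      have : clan σ F D = {D} := clan_of_level_zero (by omega)
      rw [this, env_singleton] at hq
      exact hq
    · obtain ⟨p, hp, hd⟩ := exists_near_root_of_mem_env_clan hσ F hq
      exact ⟨p, hp, hd.trans (by rw [hDn]; exact han _ (by omega))⟩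
  obtain ⟨p₁, hp₁, hd₁⟩ := back rfl hq₁
  obtain ⟨p₂, hp₂, hd₂⟩ := back hn.symm hq₂
  -- sparsity between the centres, transferred to `p₁, p₂`
  have hsparse := hF D₁ hD₁ D₂ hD₂ hne hn
  rw [le_gauge_iff] at hsparse
  simp only [Prod.fst_sub, Prod.snd_sub] at hsparse
  have hp₁x : |p₁.1 - D₁.c.1| ≤ σ.a n := Diamond.abs_sub_le_a hp₁
  have hp₁y : |p₁.2 - D₁.c.2| ≤ σ.b n := Diamond.abs_sub_le_b hp₁
  have hp₂x : |p₂.1 - D₂.c.1| ≤ σ.a n := by have := Diamond.abs_sub_le_a hp₂; rwa [← hn] at this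
  have hp₂y : |p₂.2 - D₂.c.2| ≤ σ.b n := by have := Diamond.abs_sub_le_b hp₂; rwa [← hn] at this
  have hcx : |D₁.c.1 - D₂.c.1| ≤ |p₁.1 - p₂.1| + 2 * σ.a n := by
    have t1 : |D₁.c.1 - D₂.c.1| ≤ |D₁.c.1 - p₁.1| + |p₁.1 - D₂.c.1| := abs_sub_le _ _ _
    have t2 : |p₁.1 - D₂.c.1| ≤ |p₁.1 - p₂.1| + |p₂.1 - D₂.c.1| := abs_sub_le _ _ _
    rw [abs_sub_comm D₁.c.1 p₁.1] at t1
    linarith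
  have hcy : |D₁.c.2 - D₂.c.2| ≤ |p₁.2 - p₂.2| + 2 * σ.b n := by
    have t1 : |D₁.c.2 - D₂.c.2| ≤ |D₁.c.2 - p₁.2| + |p₁.2 - D₂.c.2| := abs_sub_le _ _ _
    have t2 : |p₁.2 - D₂.c.2| ≤ |p₁.2 - p₂.2| + |p₂.2 - D₂.c.2| := abs_sub_le _ _ _
    rw [abs_sub_comm D₁.c.2 p₁.2] at t1
    linarith
  -- `dist p₁ p₂ > 15 b`
  have hM1 : |p₁.1 - p₂.1| ≤ dist p₁ p₂ := by
    rw [Prod.dist_eq, Real.dist_eq]; exact le_max_left _ _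
  have hM2 : |p₁.2 - p₂.2| ≤ dist p₁ p₂ := by
    rw [Prod.dist_eq, Real.dist_eq, Real.dist_eq]; exact le_max_right _ _
  have hp : 15 * σ.b n < dist p₁ p₂ := by
    by_contra hle
    push Not at hle
    nlinarith [mul_le_mul_of_nonneg_left hcx hb.le, mul_le_mul_of_nonneg_left hcy ha.le,
      mul_le_mul_of_nonneg_left hbn hb.le, mul_pos ha hb,
      mul_le_mul_of_nonneg_left hM1 hb.le, mul_le_mul_of_nonneg_left hM2 ha.le,
      mul_le_mul_of_nonneg_left hle hb.le, mul_le_mul_of_nonneg_left hle ha.le]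
  have t1 := dist_triangle p₁ q₁ p₂
  have t2 := dist_triangle q₁ q₂ p₂
  rw [dist_comm p₁ q₁] at t1
  linarith

/-- **Distinct root pieces are separated**: sup-distance `> b_{min level} / 4`.
[cite: Hochman2025, Prop 4.9 (3)] -/
theorem sep_of_isRoot {Λ : ℝ} (hσ : σ.Good Λ) {F : Finset Diamond} (hF : IsSparse σ F 21)
    {D₁ D₂ : Diamond} (hD₁ : IsRoot σ F D₁) (hD₂ : IsRoot σ F D₂) (hne : D₁ ≠ D₂) :
    ∀ q₁ ∈ env σ (clan σ F D₁), ∀ q₂ ∈ env σ (clan σ F D₂),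
      σ.b (min D₁.n D₂.n) / 4 < dist q₁ q₂ := by
  intro q₁ hq₁ q₂ hq₂
  rcases lt_trichotomy D₁.n D₂.n with hlt | heq | hgt
  · rw [min_eq_left hlt.le]
    exact sep_of_not_mem_clan hσ hF hD₁.1 hlt (hD₁.not_mem_clan hD₂.1 hne.symm) q₁ hq₁ q₂ hq₂
  · rw [heq, min_self]
    have := sep_of_level_eq hσ hF hD₁.1 hD₂.1 hne heq q₁ hq₁ q₂ hq₂
    rw [heq] at this
    linarith [σ.b_pos D₂.n]
  · rw [min_eq_right hgt.le, dist_comm]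
    exact sep_of_not_mem_clan hσ hF hD₂.1 hgt (hD₂.not_mem_clan hD₁.1 hne) q₂ hq₂ q₁ hq₁

/-! ### Vertical segments meet the safe set (Prop. 4.9 (3), second part; Prop. 4.1 (2)) -/

/-- The fibre of the envelope of a clan over an abscissa lies in an interval of length
`≤ 2.12 b_{D.n}` (the root's fibre, inflated by `6 b_{D.n - 1} ≤ 0.06 b_{D.n}` on each side).
[cite: Hochman2025, Prop 4.9 (2)] -/
theorem fibre_bounds_of_mem_env_clan {Λ : ℝ} (hσ : σ.Good Λ) {F : Finset Diamond} {D : Diamond}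
    {q : ℝ × ℝ} (hq : q ∈ env σ (clan σ F D)) :
    D.floor σ q.1 - 6 / 100 * σ.b D.n ≤ q.2 ∧ q.2 ≤ D.roof σ q.1 + 6 / 100 * σ.b D.n := by
  rcases Nat.eq_zero_or_pos D.n with h0 | hpos
  · rw [clan_of_level_zero h0, env_singleton] at hq
    have hb := σ.b_pos D.n
    exact ⟨by linarith [hq.1], by linarith [hq.2]⟩
  · obtain ⟨h1, h2⟩ := env_clan_subset_infl hσ hpos hq
    have hsmall : 100 * σ.b (D.n - 1) ≤ σ.b D.n := hσ.b_lt_le (Nat.sub_lt hpos Nat.one_pos)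
    exact ⟨by linarith, by linarith⟩

/-- One level of the descent: if the vertical segment `{x₀} × [u, u + 4 bₖ]` misses the pieces
of all roots of level `> k`, then one of its two end sub-segments of length `0.9 bₖ` misses the
pieces of all roots of level `≥ k` (at most one level-`k` root piece can meet the segment, since
two are `> 8 bₖ` apart, and its fibre has length `≤ 2.12 bₖ`).
[cite: Hochman2025, Prop 4.9 (3)] -/
theorem descend_vertical {Λ : ℝ} (hσ : σ.Good Λ) {F : Finset Diamond} (hF : IsSparse σ F 21)
    (x₀ : ℝ) (k : ℕ) (u : ℝ)
    (hu : ∀ D, IsRoot σ F D → k < D.n → ∀ y ∈ Icc u (u + 4 * σ.b k), (x₀, y) ∉ env σ (clan σ F D)) :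
    ∃ u', u ≤ u' ∧ u' + 9 / 10 * σ.b k ≤ u + 4 * σ.b k ∧
      ∀ D, IsRoot σ F D → k ≤ D.n →
        ∀ y ∈ Icc u' (u' + 9 / 10 * σ.b k), (x₀, y) ∉ env σ (clan σ F D) := by
  have hb := σ.b_pos k
  by_cases hmeet : ∃ D, IsRoot σ F D ∧ D.n = k ∧ ∃ y ∈ Icc u (u + 4 * σ.b k),
      (x₀, y) ∈ env σ (clan σ F D)
  · obtain ⟨D, hD, hDn, y₁, hy₁, hy₁D⟩ := hmeet
    -- every level-`k` root piece meeting the segment is this one, within `[m, m + 2.12 b]`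
    set m := D.floor σ x₀ - 6 / 100 * σ.b k with hm
    have hbad : ∀ D', IsRoot σ F D' → D'.n = k → ∀ y ∈ Icc u (u + 4 * σ.b k),
        (x₀, y) ∈ env σ (clan σ F D') → m ≤ y ∧ y ≤ m + 212 / 100 * σ.b k := by
      intro D' hD' hD'n y hy hyD'
      have hDD' : D' = D := by
        by_contra hne
        have hsep := sep_of_level_eq hσ hF hD'.1 hD.1 hne (by rw [hD'n, hDn]) _ hyD' _ hy₁D
        rw [hD'n, Prod.dist_eq, dist_self, Real.dist_eq] at hsep
        have : |y - y₁| ≤ 4 * σ.b k := by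
          rw [abs_le]; constructor <;> linarith [hy.1, hy.2, hy₁.1, hy₁.2]
        have hmax : max (0 : ℝ) |y - y₁| ≤ 4 * σ.b k := max_le (by linarith) this
        linarith
      subst hDD'
      obtain ⟨h1, h2⟩ := fibre_bounds_of_mem_env_clan hσ hyD'
      simp only at h1 h2
      rw [hD'n] at h1 h2
      refine ⟨h1, ?_⟩
      have : D'.roof σ x₀ ≤ D'.floor σ x₀ + 2 * σ.b k := by
        simp only [Diamond.roof, Diamond.floor, hD'n]
        nlinarith [abs_nonneg (x₀ - D'.c.1), σ.β_pos k]
      linarith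
    -- choose the free end
    by_cases hlow : m ≤ u + 9 / 10 * σ.b k ∧ u ≤ m + 212 / 100 * σ.b k
    · -- the bad interval meets the lower end: take the upper end
      refine ⟨u + 31 / 10 * σ.b k, by linarith, by linarith, ?_⟩
      intro D' hD' hkD' y hy hyD'
      rcases hkD'.lt_or_eq with hlt | heq
      · exact hu D' hD' hlt y ⟨by linarith [hy.1], by linarith [hy.2]⟩ hyD'
      · have := hbad D' hD' heq.symm y ⟨by linarith [hy.1], by linarith [hy.2]⟩ hyD'
        linarith [hy.1, this.2]
    · refine ⟨u, le_rfl, by linarith, ?_⟩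
      intro D' hD' hkD' y hy hyD'
      rcases hkD'.lt_or_eq with hlt | heq
      · exact hu D' hD' hlt y ⟨hy.1, by linarith [hy.2]⟩ hyD'
      · have := hbad D' hD' heq.symm y ⟨hy.1, by linarith [hy.2]⟩ hyD'
        apply hlow
        exact ⟨by linarith [this.1, hy.2], by linarith [this.2, hy.1]⟩
  · push Not at hmeet
    refine ⟨u, le_rfl, by linarith, ?_⟩
    intro D' hD' hkD' y hy hyD'
    rcases hkD'.lt_or_eq with hlt | heq
    · exact hu D' hD' hlt y ⟨hy.1, by linarith [hy.2]⟩ hyD'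
    · exact hmeet D' hD' heq.symm y ⟨hy.1, by linarith [hy.2]⟩ hyD'

/-- **Every vertical segment of length `4 b_N` contains a safe point** when all levels of the
family are `≤ N` (Prop. 4.9 (3): "every vertical line segment of length `2h_N` contains points
in the complement of `H`"; Prop. 4.1 (2)). Descend the levels: at each level keep an end
sub-segment of length `0.9 bₖ ≥ 4 bₖ₋₁` missing all root pieces of level `≥ k`.
[cite: Hochman2025, Prop 4.9 (3) and Prop 4.1 (2)] -/
theorem exists_safe_on_vertical {Λ : ℝ} (hσ : σ.Good Λ) {F : Finset Diamond} (hF : IsSparse σ F 21)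
    {N : ℕ} (hN : ∀ D ∈ F, D.n ≤ N) (x₀ u : ℝ) :
    ∃ y ∈ Icc u (u + 4 * σ.b N), (x₀, y) ∈ safe σ F := by
  -- `P k`: segments of length `4 bₖ` missing the root pieces of level `> k` contain safe points
  have P : ∀ k u, (∀ D, IsRoot σ F D → k < D.n →
      ∀ y ∈ Icc u (u + 4 * σ.b k), (x₀, y) ∉ env σ (clan σ F D)) →
      ∃ y ∈ Icc u (u + 4 * σ.b k), (x₀, y) ∈ safe σ F := by
    intro k
    induction k with
    | zero =>
      intro u hu
      obtain ⟨u', hu', hu'le, hfree⟩ := descend_vertical hσ hF x₀ 0 u hu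
      have hb := σ.b_pos 0
      refine ⟨u', ⟨hu', by linarith⟩, ?_⟩
      rw [mem_safe_iff_forall_root]
      intro D hD
      exact hfree D hD (Nat.zero_le _) u' ⟨le_rfl, by linarith⟩
    | succ k ih =>
      intro u hu
      obtain ⟨u', hu', hu'le, hfree⟩ := descend_vertical hσ hF x₀ (k + 1) u hu
      have hgrow : 100 * σ.b k ≤ σ.b (k + 1) := hσ.b_lt_le (Nat.lt_succ_self k)
      have hb := σ.b_pos k
      obtain ⟨y, hy, hysafe⟩ := ih u' (fun D hD hkD y hy => hfree D hD hkD y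
        ⟨hy.1, by linarith [hy.2]⟩)
      exact ⟨y, ⟨by linarith [hy.1], by linarith [hy.2]⟩, hysafe⟩
  refine P N u fun D hD hND y _ hy => ?_
  have := hN D hD.1
  omega


/-! ### Locality of the hull under far additions (Prop. 4.9 (5), Prop. 4.1 (4))

We compare the clans of `D` in a family `F` and in a bigger family `F' ⊇ F` stage by stage.
Two statements are proved jointly by induction on the stage `m`:
* `MEM`: a member of `F` absorbed into the `F'`-clan but not into the `F`-clan sits, in the gauge
  of some added diamond `D_A ∈ F' ∖ F` of higher level belonging to the `F'`-clan, within
  `19 - 10 (a_g/a_A + b_g/b_A)` of its centre (`g` the level of the member);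
* `PT`: a point of the `F'`-envelope outside the `F`-envelope lies within gauge
  `19 - 4 (a_λ/a_A + b_λ/b_A)` of such a `D_A` (`λ` the lowest level of the stage).
`PT` follows from `MEM` by climbing the chain of floor (or roof) witnesses of the point, and
`MEM` at the next stage follows from `PT` at the point where the new member touches the
`F'`-envelope. Consequently a safe point of `F` stays safe for any family `F'` all of whose diamonds not in
`F` are far (gauge `> 19`) from the point (`safe_mono_far`), which is the agreement form of
Prop. 4.1 (4) (`safe_of_near_mem`); no inclusion between the families is needed. -/

/-- Where a member entered the clan: a member of stage `m` other than the root entered at some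
stage `k + 1 ≤ m` as a level-`(D.n - k - 1)` diamond of the family near the stage-`k` envelope.
[cite: Hochman2025, Def 4.8] -/
theorem exists_entry_of_mem_clanStage {F : Finset Diamond} {D E : Diamond} {m : ℕ}
    (hE : E ∈ clanStage σ F D m) (hne : E ≠ D) :
    ∃ k, k < m ∧ E.n + (k + 1) = D.n ∧ E ∈ F ∧ Near σ E (clanStage σ F D k) (2 * σ.b E.n) := by
  induction m with
  | zero =>
    rw [clanStage_zero, Finset.mem_singleton] at hE
    exact absurd hE hne
  | succ m ih =>
    rw [clanStage_succ, Finset.mem_union] at hE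
    rcases hE with hE | hE
    · obtain ⟨k, hk, h⟩ := ih hE
      exact ⟨k, by omega, h⟩
    · obtain ⟨hF, hlev, hnear⟩ := Finset.mem_filter.mp hE
      exact ⟨m, Nat.lt_succ_self m, hlev, hF, hnear⟩

/-- The "multiplied-out gauge" of a vector relative to level `n`: `bₙ |v₁| + aₙ |v₂|`
(`= aₙ bₙ · ν_n(v)`). [folklore] -/
def mgauge (σ : Scales) (n : ℕ) (v : ℝ × ℝ) : ℝ := σ.b n * |v.1| + σ.a n * |v.2|

/-- `mgauge` and `gauge`. [folklore] -/
theorem gauge_le_iff_mgauge {n : ℕ} {v : ℝ × ℝ} {K : ℝ} :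
    gauge σ n v ≤ K ↔ mgauge σ n v ≤ K * (σ.a n * σ.b n) := gauge_le_iff

/-- Triangle inequality for `mgauge`. [folklore] -/
theorem mgauge_add_le (n : ℕ) (u v : ℝ × ℝ) : mgauge σ n (u + v) ≤ mgauge σ n u + mgauge σ n v := by
  simp only [mgauge, Prod.fst_add, Prod.snd_add]
  have h1 := abs_add_le u.1 v.1
  have h2 := abs_add_le u.2 v.2
  nlinarith [σ.a_pos n, σ.b_pos n]

/-- `mgauge` from coordinate bounds. [folklore] -/
theorem mgauge_le_of_abs_le {n : ℕ} {v : ℝ × ℝ} {x y : ℝ} (hx : |v.1| ≤ x) (hy : |v.2| ≤ y) :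
    mgauge σ n v ≤ σ.b n * x + σ.a n * y := by
  simp only [mgauge]
  nlinarith [σ.a_pos n, σ.b_pos n]

/-- The slack term `a_g b_A + b_g a_A` (`= a_A b_A (a_g/a_A + b_g/b_A)`). [folklore] -/
def slackTerm (σ : Scales) (g nA : ℕ) : ℝ := σ.a g * σ.b nA + σ.b g * σ.a nA

/-- The slack term is positive. [folklore] -/
theorem slackTerm_pos (g nA : ℕ) : 0 < slackTerm σ g nA :=
  add_pos (mul_pos (σ.a_pos g) (σ.b_pos nA)) (mul_pos (σ.b_pos g) (σ.a_pos nA))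

/-- The slack term is at most `2 a_A b_A` when `g ≤ n_A`. [folklore] -/
theorem slackTerm_le {Λ : ℝ} (hσ : σ.Good Λ) {g nA : ℕ} (h : g ≤ nA) :
    slackTerm σ g nA ≤ 2 * (σ.a nA * σ.b nA) := by
  unfold slackTerm
  have h1 := hσ.a_mono h
  have h2 := hσ.b_mono h
  nlinarith [σ.a_pos g, σ.b_pos g, σ.a_pos nA, σ.b_pos nA]

/-- The slack term grows hundredfold per level. [folklore] -/
theorem slackTerm_lt_le {Λ : ℝ} (hσ : σ.Good Λ) {g g' nA : ℕ} (h : g < g') :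
    100 * slackTerm σ g nA ≤ slackTerm σ g' nA := by
  unfold slackTerm
  have h1 := hσ.a_lt_le' h
  have h2 := hσ.b_lt_le h
  nlinarith [σ.a_pos nA, σ.b_pos nA]

/-- The slack term is monotone in the level. [folklore] -/
theorem slackTerm_mono {Λ : ℝ} (hσ : σ.Good Λ) {g g' nA : ℕ} (h : g ≤ g') :
    slackTerm σ g nA ≤ slackTerm σ g' nA := by
  rcases h.lt_or_eq with hlt | rfl
  · have := slackTerm_lt_le hσ (nA := nA) hlt
    linarith [slackTerm_pos (σ := σ) g nA]
  · exact le_rfl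

section Locality

variable {Λ : ℝ} (hσ : σ.Good Λ) {F F' : Finset Diamond} {D : Diamond}

/-- The statement `MEM m` of the locality induction (see the section doc).
[cite: Hochman2025, Prop 4.9 (5)] -/
def LocMem (σ : Scales) (F F' : Finset Diamond) (D : Diamond) (m : ℕ) : Prop :=
  ∀ G ∈ clanStage σ F' D m, G ∉ clanStage σ F D m → G ∈ F →
    ∃ A ∈ clanStage σ F' D m, A ∈ F' ∧ A ∉ F ∧ G.n < A.n ∧
      mgauge σ A.n (G.c - A.c) ≤ 19 * (σ.a A.n * σ.b A.n) - 10 * slackTerm σ G.n A.n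

/-- The statement `PT m` of the locality induction (see the section doc).
[cite: Hochman2025, Prop 4.9 (5)] -/
def LocPt (σ : Scales) (F F' : Finset Diamond) (D : Diamond) (m : ℕ) : Prop :=
  ∀ q ∈ env σ (clanStage σ F' D m), q ∉ env σ (clanStage σ F D m) →
    ∃ A ∈ clanStage σ F' D m, A ∈ F' ∧ A ∉ F ∧
      mgauge σ A.n (q - A.c) ≤ 19 * (σ.a A.n * σ.b A.n) - 4 * slackTerm σ (D.n - m) A.n

include hσ

/-- **The chain of floor witnesses** (from `MEM m` to `PT m`, floor side): if every floor of the
`F`-stage is above `q`, then any member `G` of the `F'`-stage whose floor at `q.1` is below `q.2`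
leads, climbing through dominators and through the envelope point where `G` was absorbed, to
an added diamond near `q`. [cite: Hochman2025, Prop 4.9 (5)] -/
theorem chain_floor {m : ℕ} (hmem : LocMem σ F F' D m) (hm : m ≤ D.n) {q : ℝ × ℝ}
    (habove : ∀ G ∈ clanStage σ F D m, q.2 < G.floor σ q.1) :
    ∀ t : ℕ, ∀ G ∈ clanStage σ F' D m, D.n ≤ G.n + t → G.floor σ q.1 ≤ q.2 →
      ∃ A ∈ clanStage σ F' D m, A ∈ F' ∧ A ∉ F ∧
        mgauge σ A.n (q - A.c) ≤ 19 * (σ.a A.n * σ.b A.n) - 4 * slackTerm σ (D.n - m) A.n := by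
  intro t
  induction t with
  | zero =>
    intro G hG hlev hfl
    -- `G = D`, which is in the `F`-stage: contradiction
    rcases mem_clanStage_iff_level hG with rfl | ⟨-, hlt, -⟩
    · exact absurd hfl (not_le.mpr (habove G (self_mem_clanStage F G m)))
    · omega
  | succ t ih =>
    intro G hG hlev hfl
    have hGD : G ≠ D := by
      rintro rfl; exact absurd hfl (not_le.mpr (habove G (self_mem_clanStage F G m)))
    obtain ⟨k, hkm, hklev, hGF', hnear⟩ := exists_entry_of_mem_clanStage hG hGD
    set g := G.n with hg
    have hSk : ∀ E' ∈ clanStage σ F' D k, G.n < E'.n := by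
      intro E' hE'; have := level_ge_of_mem_clanStage hE'; omega
    have hsub : clanStage σ F' D k ⊆ clanStage σ F' D m := clanStage_subset_of_le F' D hkm.le
    -- lowest level of stage `m` is `D.n - m ≤ g`
    have hlow : D.n - m ≤ g := by omega
    have ha := σ.a_pos g
    have hb := σ.b_pos g
    have hβa : σ.β g * σ.a g = σ.b g := σ.β_mul_a g
    -- (1) far from `G` horizontally: climb to the floor dominator
    by_cases hfar : 6 * σ.a g ≤ |q.1 - G.c.1|
    · obtain ⟨G₀, hG₀, hdom⟩ := exists_floor_dom hσ hSk hnear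
      have h0 := (hdom q.1).2 hfar
      exact ih G₀ (hsub hG₀) (by have := hSk G₀ hG₀; omega) (h0.trans hfl)
    push Not at hfar
    -- (2) the envelope point where `G` was absorbed, and its floor witness `G''`
    obtain ⟨e, he, e', he', hd⟩ := hnear
    obtain ⟨hd1, hd2⟩ := abs_sub_le_of_dist_le hd
    obtain ⟨⟨G'', hG'', hG''fl⟩, -⟩ := he'
    have hβ'' : σ.β G''.n ≤ σ.β g / 10 := hσ.β_lt_le (hSk G'' hG'')
    have hex : |e.1 - G.c.1| ≤ σ.a g := Diamond.abs_sub_le_a he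
    have hey : |e.2 - G.c.2| ≤ σ.b g := Diamond.abs_sub_le_b he
    have hqe' : |q.1 - e'.1| ≤ 7 * σ.a g + 2 * σ.b g := by
      have t1 : |q.1 - e'.1| ≤ |q.1 - G.c.1| + |G.c.1 - e'.1| := abs_sub_le _ _ _
      have t2 : |G.c.1 - e'.1| ≤ |G.c.1 - e.1| + |e.1 - e'.1| := abs_sub_le _ _ _
      rw [abs_sub_comm G.c.1 e.1] at t2
      linarith
    have hG''q : G''.floor σ q.1 ≤ G.c.2 + 372 / 100 * σ.b g := by
      have t1 : G''.floor σ q.1 ≤ G''.floor σ e'.1 + σ.β G''.n * |q.1 - e'.1| := by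
        simp only [Diamond.floor]
        have : |q.1 - G''.c.1| ≤ |q.1 - e'.1| + |e'.1 - G''.c.1| := abs_sub_le _ _ _
        nlinarith [σ.β_pos G''.n, abs_nonneg (q.1 - e'.1)]
      have t2 : σ.β G''.n * |q.1 - e'.1| ≤ σ.β g / 10 * (7 * σ.a g + 2 * σ.b g) :=
        mul_le_mul hβ'' hqe' (abs_nonneg _) (div_nonneg (σ.β_pos g).le (by norm_num))
      have t3 : σ.β g / 10 * (7 * σ.a g + 2 * σ.b g) ≤ 72 / 100 * σ.b g := by
        have hβb : σ.β g * σ.b g ≤ σ.b g / 10 := hσ.β_mul_b_le g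
        nlinarith
      rw [abs_le] at hey hd2
      linarith
    by_cases hup : G''.floor σ q.1 ≤ q.2
    · -- climb to `G''`
      exact ih G'' (hsub hG'') (by have := hSk G'' hG''; omega) hup
    push Not at hup
    -- (3) `q` is near `G`: `|dx| < 6a`, `-b ≤ dy ≤ 3.72 b`
    have hqlow : G.c.2 - σ.b g ≤ q.2 := by
      have : G.c.2 - σ.b g ≤ G.floor σ q.1 := by
        simp only [Diamond.floor]; nlinarith [abs_nonneg (q.1 - G.c.1), σ.β_pos g]
      linarith
    have hqG : mgauge σ g (q - G.c) ≤ 10 * (σ.a g * σ.b g) := by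
      have hy : |q.2 - G.c.2| ≤ 372 / 100 * σ.b g := by
        rw [abs_le]; constructor <;> linarith
      have := mgauge_le_of_abs_le (σ := σ) (n := g) (v := q - G.c) (by simpa using hfar.le)
        (by simpa using hy)
      nlinarith
    by_cases hGF : G ∈ F
    · -- `G ∈ F`: it is not in the `F`-stage (its floor is below `q`), so `MEM` applies
      have hGnot : G ∉ clanStage σ F D m := fun h => absurd hfl (not_le.mpr (habove G h))
      obtain ⟨A, hA, hAF', hAF, hgA, hmg⟩ := hmem G hG hGnot hGF
      refine ⟨A, hA, hAF', hAF, ?_⟩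
      -- transfer the nearness of `q` to `G` into the gauge of `A`
      have hratio_a := hσ.a_lt_le' hgA
      have hratio_b := hσ.b_lt_le hgA
      have hqGA : mgauge σ A.n (q - G.c) ≤ 6 * slackTerm σ g A.n := by
        have hy : |q.2 - G.c.2| ≤ 372 / 100 * σ.b g := by
          rw [abs_le]; constructor <;> linarith
        have := mgauge_le_of_abs_le (σ := σ) (n := A.n) (v := q - G.c) (by simpa using hfar.le)
          (by simpa using hy)
        unfold slackTerm
        nlinarith [σ.a_pos A.n, σ.b_pos A.n]
      have htri := mgauge_add_le (σ := σ) A.n (q - G.c) (G.c - A.c)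
      rw [show q - G.c + (G.c - A.c) = q - A.c by abel] at htri
      have hsl : slackTerm σ (D.n - m) A.n ≤ slackTerm σ g A.n := slackTerm_mono hσ hlow
      linarith [slackTerm_pos (σ := σ) g A.n]
    · -- `G` is itself an added diamond
      refine ⟨G, hG, hGF', hGF, ?_⟩
      have hsl : slackTerm σ (D.n - m) g ≤ 2 * (σ.a g * σ.b g) := slackTerm_le hσ hlow
      rw [← hg]
      nlinarith [mul_pos ha hb]

/-- **The chain of roof witnesses** (mirror image of `chain_floor`). [cite: Hochman2025, Prop 4.9 (5)] -/
theorem chain_roof {m : ℕ} (hmem : LocMem σ F F' D m) (hm : m ≤ D.n) {q : ℝ × ℝ}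
    (hbelow : ∀ G ∈ clanStage σ F D m, G.roof σ q.1 < q.2) :
    ∀ t : ℕ, ∀ G ∈ clanStage σ F' D m, D.n ≤ G.n + t → q.2 ≤ G.roof σ q.1 →
      ∃ A ∈ clanStage σ F' D m, A ∈ F' ∧ A ∉ F ∧
        mgauge σ A.n (q - A.c) ≤ 19 * (σ.a A.n * σ.b A.n) - 4 * slackTerm σ (D.n - m) A.n := by
  intro t
  induction t with
  | zero =>
    intro G hG hlev hfl
    rcases mem_clanStage_iff_level hG with rfl | ⟨-, hlt, -⟩
    · exact absurd hfl (not_le.mpr (hbelow G (self_mem_clanStage F G m)))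
    · omega
  | succ t ih =>
    intro G hG hlev hfl
    have hGD : G ≠ D := by
      rintro rfl; exact absurd hfl (not_le.mpr (hbelow G (self_mem_clanStage F G m)))
    obtain ⟨k, hkm, hklev, hGF', hnear⟩ := exists_entry_of_mem_clanStage hG hGD
    set g := G.n with hg
    have hSk : ∀ E' ∈ clanStage σ F' D k, G.n < E'.n := by
      intro E' hE'; have := level_ge_of_mem_clanStage hE'; omega
    have hsub : clanStage σ F' D k ⊆ clanStage σ F' D m := clanStage_subset_of_le F' D hkm.le
    -- lowest level of stage `m` is `D.n - m ≤ g`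
    have hlow : D.n - m ≤ g := by omega
    have ha := σ.a_pos g
    have hb := σ.b_pos g
    have hβa : σ.β g * σ.a g = σ.b g := σ.β_mul_a g
    -- (1) far from `G` horizontally: climb to the roof dominator
    by_cases hfar : 6 * σ.a g ≤ |q.1 - G.c.1|
    · obtain ⟨G₀, hG₀, hdom⟩ := exists_roof_dom hσ hSk hnear
      have h0 := (hdom q.1).2 hfar
      exact ih G₀ (hsub hG₀) (by have := hSk G₀ hG₀; omega) (hfl.trans h0)
    push Not at hfar
    -- (2) the envelope point where `G` was absorbed, and its roof witness `G''`
    obtain ⟨e, he, e', he', hd⟩ := hnear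
    obtain ⟨hd1, hd2⟩ := abs_sub_le_of_dist_le hd
    obtain ⟨-, ⟨G'', hG'', hG''fl⟩⟩ := he'
    have hβ'' : σ.β G''.n ≤ σ.β g / 10 := hσ.β_lt_le (hSk G'' hG'')
    have hex : |e.1 - G.c.1| ≤ σ.a g := Diamond.abs_sub_le_a he
    have hey : |e.2 - G.c.2| ≤ σ.b g := Diamond.abs_sub_le_b he
    have hqe' : |q.1 - e'.1| ≤ 7 * σ.a g + 2 * σ.b g := by
      have t1 : |q.1 - e'.1| ≤ |q.1 - G.c.1| + |G.c.1 - e'.1| := abs_sub_le _ _ _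
      have t2 : |G.c.1 - e'.1| ≤ |G.c.1 - e.1| + |e.1 - e'.1| := abs_sub_le _ _ _
      rw [abs_sub_comm G.c.1 e.1] at t2
      linarith
    have hG''q : G.c.2 - 372 / 100 * σ.b g ≤ G''.roof σ q.1 := by
      have t1 : G''.roof σ e'.1 - σ.β G''.n * |q.1 - e'.1| ≤ G''.roof σ q.1 := by
        simp only [Diamond.roof]
        have : |q.1 - G''.c.1| ≤ |q.1 - e'.1| + |e'.1 - G''.c.1| := abs_sub_le _ _ _
        nlinarith [σ.β_pos G''.n, abs_nonneg (q.1 - e'.1)]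
      have t2 : σ.β G''.n * |q.1 - e'.1| ≤ σ.β g / 10 * (7 * σ.a g + 2 * σ.b g) :=
        mul_le_mul hβ'' hqe' (abs_nonneg _) (div_nonneg (σ.β_pos g).le (by norm_num))
      have t3 : σ.β g / 10 * (7 * σ.a g + 2 * σ.b g) ≤ 72 / 100 * σ.b g := by
        have hβb : σ.β g * σ.b g ≤ σ.b g / 10 := hσ.β_mul_b_le g
        nlinarith
      rw [abs_le] at hey hd2
      linarith
    by_cases hup : q.2 ≤ G''.roof σ q.1
    · -- climb to `G''`
      exact ih G'' (hsub hG'') (by have := hSk G'' hG''; omega) hup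
    push Not at hup
    -- (3) `q` is near `G`: `|dx| < 6a`, `-3.72 b ≤ dy ≤ b`
    have hqlow : q.2 ≤ G.c.2 + σ.b g := by
      have : G.roof σ q.1 ≤ G.c.2 + σ.b g := by
        simp only [Diamond.roof]; nlinarith [abs_nonneg (q.1 - G.c.1), σ.β_pos g]
      linarith
    have hqG : mgauge σ g (q - G.c) ≤ 10 * (σ.a g * σ.b g) := by
      have hy : |q.2 - G.c.2| ≤ 372 / 100 * σ.b g := by
        rw [abs_le]; constructor <;> linarith
      have := mgauge_le_of_abs_le (σ := σ) (n := g) (v := q - G.c) (by simpa using hfar.le)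
        (by simpa using hy)
      nlinarith
    by_cases hGF : G ∈ F
    · -- `G ∈ F`: it is not in the `F`-stage (its roof is above `q`), so `MEM` applies
      have hGnot : G ∉ clanStage σ F D m := fun h => absurd hfl (not_le.mpr (hbelow G h))
      obtain ⟨A, hA, hAF', hAF, hgA, hmg⟩ := hmem G hG hGnot hGF
      refine ⟨A, hA, hAF', hAF, ?_⟩
      -- transfer the nearness of `q` to `G` into the gauge of `A`
      have hratio_a := hσ.a_lt_le' hgA
      have hratio_b := hσ.b_lt_le hgA
      have hqGA : mgauge σ A.n (q - G.c) ≤ 6 * slackTerm σ g A.n := by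
        have hy : |q.2 - G.c.2| ≤ 372 / 100 * σ.b g := by
          rw [abs_le]; constructor <;> linarith
        have := mgauge_le_of_abs_le (σ := σ) (n := A.n) (v := q - G.c) (by simpa using hfar.le)
          (by simpa using hy)
        unfold slackTerm
        nlinarith [σ.a_pos A.n, σ.b_pos A.n]
      have htri := mgauge_add_le (σ := σ) A.n (q - G.c) (G.c - A.c)
      rw [show q - G.c + (G.c - A.c) = q - A.c by abel] at htri
      have hsl : slackTerm σ (D.n - m) A.n ≤ slackTerm σ g A.n := slackTerm_mono hσ hlow
      linarith [slackTerm_pos (σ := σ) g A.n]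
    · -- `G` is itself an added diamond
      refine ⟨G, hG, hGF', hGF, ?_⟩
      have hsl : slackTerm σ (D.n - m) g ≤ 2 * (σ.a g * σ.b g) := slackTerm_le hσ hlow
      rw [← hg]
      nlinarith [mul_pos ha hb]

/-- **`PT m` from `MEM m`.** [cite: Hochman2025, Prop 4.9 (5)] -/
theorem locPt_of_locMem {m : ℕ} (hmem : LocMem σ F F' D m) (hm : m ≤ D.n) : LocPt σ F F' D m := by
  intro q hq hqS
  rw [mem_env, not_and_or] at hqS
  obtain ⟨⟨G₁, hG₁, hG₁fl⟩, ⟨G₂, hG₂, hG₂ro⟩⟩ := hq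
  rcases hqS with h | h
  · push Not at h
    exact chain_floor hσ hmem hm h D.n G₁ hG₁ (Nat.le_add_left _ _) hG₁fl
  · push Not at h
    exact chain_roof hσ hmem hm h D.n G₂ hG₂ (Nat.le_add_left _ _) hG₂ro

/-- **`MEM (m+1)` from `MEM m` and `PT m`**: a member of `F` newly absorbed into the `F'`-clan
but not into the `F`-clan touches the `F'`-envelope at a point outside the `F`-envelope, which
`PT m` places near an added diamond of higher level. [cite: Hochman2025, Prop 4.9 (5)] -/
theorem locMem_succ {m : ℕ} (hmem : LocMem σ F F' D m) (hpt : LocPt σ F F' D m)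
    (hm : m + 1 ≤ D.n) : LocMem σ F F' D (m + 1) := by
  intro G hG hGnot hGF
  rw [clanStage_succ, Finset.mem_union] at hG
  have hsub : clanStage σ F' D m ⊆ clanStage σ F' D (m + 1) := clanStage_subset_succ F' D m
  rcases hG with hG | hG
  · have hGnot' : G ∉ clanStage σ F D m := fun h => hGnot (clanStage_subset_succ F D m h)
    obtain ⟨A, hA, h1, h2, h3, h4⟩ := hmem G hG hGnot' hGF
    exact ⟨A, hsub hA, h1, h2, h3, h4⟩
  · obtain ⟨-, hlev, hnear⟩ := Finset.mem_filter.mp hG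
    set g := G.n with hg
    -- `G` is not near the `F`-stage (else it would be in the `F`-clan at stage `m + 1`)
    have hnotnear : ¬ Near σ G (clanStage σ F D m) (2 * σ.b g) := by
      intro h
      apply hGnot
      rw [clanStage_succ, Finset.mem_union, Finset.mem_filter]
      exact Or.inr ⟨hGF, hlev, h⟩
    obtain ⟨e, he, e', he', hd⟩ := hnear
    have he'S : e' ∉ env σ (clanStage σ F D m) := fun h => hnotnear ⟨e, he, e', h, hd⟩
    obtain ⟨A, hA, hAF', hAF, hmg⟩ := hpt e' he' he'S
    have hAlev : D.n ≤ A.n + m := level_ge_of_mem_clanStage hA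
    have hgA : g < A.n := by omega
    refine ⟨A, hsub hA, hAF', hAF, hgA, ?_⟩
    -- `G.c` is within `(a_g + 2 b_g, 3 b_g)` of `e'`
    obtain ⟨hd1, hd2⟩ := abs_sub_le_of_dist_le hd
    have hex : |e.1 - G.c.1| ≤ σ.a g := Diamond.abs_sub_le_a he
    have hey : |e.2 - G.c.2| ≤ σ.b g := Diamond.abs_sub_le_b he
    have hx : |G.c.1 - e'.1| ≤ σ.a g + 2 * σ.b g := by
      have : |G.c.1 - e'.1| ≤ |G.c.1 - e.1| + |e.1 - e'.1| := abs_sub_le _ _ _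
      rw [abs_sub_comm G.c.1 e.1] at this
      linarith
    have hy : |G.c.2 - e'.2| ≤ 3 * σ.b g := by
      have : |G.c.2 - e'.2| ≤ |G.c.2 - e.2| + |e.2 - e'.2| := abs_sub_le _ _ _
      rw [abs_sub_comm G.c.2 e.2] at this
      linarith
    have hGe' : mgauge σ A.n (G.c - e') ≤ 3 * slackTerm σ g A.n := by
      have := mgauge_le_of_abs_le (σ := σ) (n := A.n) (v := G.c - e') (by simpa using hx)
        (by simpa using hy)
      have hbg : σ.b g ≤ σ.a g / 10 := hσ.b_le g
      unfold slackTerm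
      nlinarith [σ.a_pos A.n, σ.b_pos A.n, σ.a_pos g, σ.b_pos g]
    have htri := mgauge_add_le (σ := σ) A.n (G.c - e') (e' - A.c)
    rw [show G.c - e' + (e' - A.c) = G.c - A.c by abel] at htri
    -- the slack at the lowest level `D.n - m = g + 1` of stage `m` dominates
    have hlev' : D.n - m = g + 1 := by omega
    rw [hlev'] at hmg
    have hgrow : 100 * slackTerm σ g A.n ≤ slackTerm σ (g + 1) A.n :=
      slackTerm_lt_le hσ (Nat.lt_succ_self g)
    linarith [slackTerm_pos (σ := σ) g A.n]

/-- **The locality induction**: `MEM m` and `PT m` hold at every stage.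
[cite: Hochman2025, Prop 4.9 (5)] -/
theorem locMem_locPt : ∀ m, m ≤ D.n → LocMem σ F F' D m ∧ LocPt σ F F' D m := by
  intro m
  induction m with
  | zero =>
    intro _
    have hmem : LocMem σ F F' D 0 := by
      intro G hG hGnot _
      rw [clanStage_zero] at hG hGnot
      exact absurd hG hGnot
    exact ⟨hmem, locPt_of_locMem hσ hmem (Nat.zero_le _)⟩
  | succ m ih =>
    intro hm
    obtain ⟨hmem, hpt⟩ := ih (by omega)
    have hmem' := locMem_succ hσ hmem hpt hm
    exact ⟨hmem', locPt_of_locMem hσ hmem' hm⟩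

/-- **Far additions do not destroy safe points** (Prop. 4.9 (5) / Prop. 4.1 (4)): if `p` is
safe for `F` and every diamond of `F' ∖ F` is at gauge distance `> 19` from `p` (`p ∉ 19·A`),
then `p` is safe for `F'` (no inclusion between `F` and `F'` is needed: removals are covered by
the same comparison of the two clans of each `D`). [cite: Hochman2025, Prop 4.9 (5)] -/
theorem safe_mono_far {p : ℝ × ℝ} (hp : p ∈ safe σ F)
    (hfar : ∀ A ∈ F', A ∉ F → 19 < gauge σ A.n (p - A.c)) : p ∈ safe σ F' := by
  rw [mem_safe_iff]
  intro D hD hpD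
  by_cases hDF : D ∈ F
  · have hpnot : p ∉ env σ (clan σ F D) := (mem_safe_iff.mp hp) D hDF
    obtain ⟨-, hpt⟩ := locMem_locPt hσ (D := D) D.n le_rfl
    obtain ⟨A, hA, hAF', hAF, hmg⟩ := hpt p (by simpa [clan] using hpD) (by simpa [clan] using hpnot)
    have h1 := hfar A hAF' hAF
    have h2 : gauge σ A.n (p - A.c) ≤ 19 := by
      rw [gauge_le_iff_mgauge]
      linarith [slackTerm_pos (σ := σ) (D.n - D.n) A.n]
    linarith
  · -- `D` itself was added: its piece lies in `2·D`
    have := env_clan_subset_scaled_two hσ D hpD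
    have h2 : gauge σ D.n (p - D.c) ≤ 2 := this
    have h1 := hfar D hD hDF
    linarith

/-- **Prop. 4.1 (4) / Prop. 4.9 (5), agreement form**: if every diamond of `F'` at gauge
distance `≤ 19` from `p` belongs to `F`, then safety for `F` implies safety for `F'`
(antitonicity down to `F ∩ F'`, then far additions). In Hochman's formulation: if `R'` agrees
with `R` near `p` ("`{R ∈ R_n | p ∈ 40R} = {R' ∈ R'_n | p ∈ 40R'}`") then `p ∈ safe(R)`
implies `p ∈ safe(R')`. [cite: Hochman2025, Prop 4.1 (4) and Prop 4.9 (5)] -/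
theorem safe_of_near_mem {p : ℝ × ℝ} (hnear : ∀ A ∈ F', gauge σ A.n (p - A.c) ≤ 19 → A ∈ F)
    (hp : p ∈ safe σ F) : p ∈ safe σ F' := by
  refine safe_mono_far hσ hp fun A hA hAnot => ?_
  by_contra hle
  push Not at hle
  exact hAnot (hnear A hA hle)

end Locality

end SafePoints

end Hochman2025

end Literature.Dynamics.SymbolicDynamics
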